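import Literature.Analysis.FluidPDE.EulerFourierGalerkinEnergy
import HarnessLib

/-!
# The Fourier–Galerkin solutions form a Cauchy family in `C([0, τ]; L²)` as the cut-off is
# removed (Majda–Bertozzi 2002, Lemma 3.7 (3.61), on the Fourier side, inviscid case)

Fourth file of the Fourier–Galerkin construction of local smooth solutions of the Euler equations
on `ℝ³` with `H³`-controlled lifespan (discharge of
`Literature.Analysis.FluidPDE.MajdaBertozzi2002_localExistenceH3`, `NSVorticityBKM.lean`;
A. J. Majda, A. L. Bertozzi, *Vorticity and Incompressible Flow*, CUP 2002, §3.2). Having the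
global regularised solutions (`EulerFourierGalerkin`) and their `H^m` bounds uniform in the
regularisation on the `H³` lifespan `[0, τ(A)]` (`EulerFourierGalerkinEnergy`), Majda–Bertozzi
show (Lemma 3.7, (3.61), pp. 107–108) that the family is Cauchy in `C([0,T]; L²)`:
`d/dt ‖v^ε − v^{ε'}‖₀ ≤ C(M)[max(ε,ε') + ‖v^ε − v^{ε'}‖₀]`, by subtracting the two equations,
pairing with the difference, estimating the terms `R1`–`R4` with the mollifier bounds (3.40) and
the uniform `H^m` bound, the symmetry killing `R5`, and Grönwall. This file proves the Fourier-side
counterpart for the inviscid (`c = 0`) Galerkin system with sharp cut-offs `χ_R`, `χ_{R'}`,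
`0 ≤ R ≤ R'`, the role of `ε` being played by `1/(1+R)`:

* `cauchy_deriv_le` — for states `u` (radius `R`) and `v` (radius `R'`) of the phase space with
  `E_3 ≤ 4(A+1)` and `u = a` a.e. off the ball `‖ξ‖ ≤ R` (which Galerkin solutions satisfy,
  `galerkin_solution_eq_initial_of_lt`), for a datum with `∫⁻((1+‖ξ‖)³‖a(ξ)‖)² ≤ A`,
  `2 Re ⟪u − v, F_R(u) − F_{R'}(v)⟫ ≤ (432πW(A+1)^{1/2} + 1)‖u − v‖² + (2160πW(A+1))²/(1+R)²`.
  Writing `f = χ_Ru`, `f' = χ_{R'}v`, `w = u − v`, `g' = χ_{R'}w`, `δa = (χ_{R'} − χ_R)a`, one has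
  `f' − f = δa − g'` a.e. (`truncCoeff_sub_truncCoeff_ae`) and
  `⟪w, F_R u − F_{R'} v⟫ = I' − I = J₁ − J₂ + J₃ − J₄ + J₅` with `J₁ = ∫∑N(δa,f')ḡ'` (MB's `R3`-type
  term, small by the tail of the datum, `lintegral_tail_sq_rpow_le`: `‖δa‖₂ ≤ A^{1/2}/(1+R)³`),
  `J₂ = ∫∑N(g',f')ḡ'` (MB's `R4`, `≲ ‖w‖²`), `J₃ = ∫∑N(f,δa)ḡ'` (small by the weighted tail),
  `Re J₄ = Re ∫∑N(f,g')ḡ' = 0` (MB's `R5`, `re_integral_sum_nonlin_mul_conj_eq_zero`), and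
  `J₅ = ∫∑N(f,f)(ḡ' − ḡ)` (MB's `R1`/`R2`, small because `g' − g` lives off the ball of radius `R`,
  where the weight `1+‖ξ‖` is `≥ 1+R`: `lintegral_sum_weight_enorm_nonlin_mul_le`, Peetre on the
  majorant convolution). Each term is bounded by the trilinear bounds
  `lintegral_sum_enorm_nonlin_mul_le(')` (Cauchy–Schwarz in `ξ` and Young, with the `L¹_ξ` norm on
  the factor that the uniform `H³` bound controls through `∫‖f‖ ≤ W E_3^{1/2}`,
  `∫‖ζ‖‖f‖ ≤ W E_3^{1/2}`, `W = ‖(1+‖·‖)^{-2}‖_{L²(ℝ³)}`).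
* `norm_sub_le_of_galerkin_solutions` — **the Cauchy estimate**: two inviscid Galerkin solutions
  with radii `0 ≤ R ≤ R'` from the same datum satisfy `‖α_R(t) − α_{R'}(t)‖ ≤ D(A)/(1+R)` on
  `[0, T]`, `T ≤ τ(A)`, with `D(A) = cauchyConst A` explicit (Grönwall,
  `le_gronwallBound_of_liminf_deriv_right_le`).

Only the inviscid case is treated: for `ν > 0` the target fact allows a `ν`-dependent lifespan and
the tree's proved Picard theorem `tao2011_sobolevMild_exists_holds` applies, so the Galerkin limit
is needed for `ν = 0` only. No facts are introduced; the one definition is the constant `D(A)`.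

## Mathlib / tree search

Tree: `enorm_nonlin_le_of_divFree`, `lintegral_mul_lconv_le(')`, `re_integral_sum_nonlin_mul_conj_eq_zero`,
`enorm_ofReal_mul` (`EulerFourierTransport`); `weight_mul_lconv_le`, `sq_lintegral_le_weight`,
`measurable_ofReal_weight`, `aemeasurable_lconvolution`, `continuous_fconv_of_memLp`
(`FourierL2Convolution`); `nonlin_sub_left/right_of_memLp`, `lintegral_enorm_sq_rpow_half_eq_eLpNorm`
(`FourierL2Nonlin`/`FourierL2Picard`); the `truncCoeff`/`galerkinField` API of `EulerFourierGalerkin`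
and `truncEnergy_three_le`, `lintegral_norm_mul_truncCoeff_le`, `ofReal_truncEnergy_le_lintegral`
of `EulerFourierGalerkinEnergy`. Mathlib: `gronwallBound_of_K_ne_0`,
`le_gronwallBound_of_liminf_deriv_right_le`, `HasDerivWithinAt.inner`, `integral_add'/sub'`,
`enorm_integral_le_lintegral_enorm`, `pow_le_pow_iff_left₀`.

## References

* A. J. Majda, A. L. Bertozzi, *Vorticity and Incompressible Flow*, CUP 2002: Lemma 3.5 (3.40)
  (p. 99), Thm. 3.4 (p. 104), Lemma 3.7 and its proof (3.61), terms `R1`–`R5` (pp. 107–108).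
  [MajdaBertozzi2002]
-/

noncomputable section

open MeasureTheory Real Set Filter Function Metric
open scoped ENNReal NNReal ComplexConjugate InnerProductSpace Convolution
open _root_.Topology

namespace Literature.Analysis.FluidPDE.FourierNS

/-! ### Trilinear bounds for the paired nonlinearity -/

section Trilinear

variable {ι : Type*} [Fintype ι] [DecidableEq ι]
variable {p q r : EuclideanSpace ℝ ι → ι → ℂ}

/-- **Paired nonlinearity, `L¹` on the weighted transported factor**: for a divergence-free
transporting field `p` (`p_j ∈ L²`), a transported field `q` (`q_k`, `‖·‖q_k ∈ L²`) and a measurable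
pairing field `r`,
`∫⁻ ∑_l ‖N(p,q)_l‖ ‖r_l‖ ≤ 4π ∑_{l,j,k} ‖r_l‖₂ ‖p_j‖₂ ‖‖·‖ q_k‖₁` (Cauchy–Schwarz in `ξ` and Young).
[folklore] -/
theorem lintegral_sum_enorm_nonlin_mul_le
    (hdiv : ∀ᵐ ζ ∂(volume : Measure (EuclideanSpace ℝ ι)), ∑ j, ((ζ j : ℝ) : ℂ) * p ζ j = 0)
    (hp2 : ∀ j, MemLp (fun ζ => p ζ j) 2 volume) (hq2 : ∀ k, MemLp (fun η => q η k) 2 volume)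
    (hqw : ∀ k, MemLp (fun η => ((‖η‖ : ℝ) : ℂ) * q η k) 2 volume)
    (hr : AEStronglyMeasurable r volume) :
    ∫⁻ ξ, ∑ l, ‖nonlin p q ξ l‖ₑ * ‖r ξ l‖ₑ ≤ ENNReal.ofReal (4 * π) * ∑ l, ∑ j, ∑ k,
      (∫⁻ ξ, ‖r ξ l‖ₑ ^ 2) ^ (1 / 2 : ℝ) * (∫⁻ ζ, ‖p ζ j‖ₑ ^ 2) ^ (1 / 2 : ℝ) *
        ∫⁻ η, ENNReal.ofReal ‖η‖ * ‖q η k‖ₑ := by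
  set Φ : ι → EuclideanSpace ℝ ι → ℝ≥0∞ := fun k η => ENNReal.ofReal ‖η‖ * ‖q η k‖ₑ with hΦ
  set Ψ : ι → EuclideanSpace ℝ ι → ℝ≥0∞ := fun j ζ => ‖p ζ j‖ₑ with hΨ
  set Θ : ι → EuclideanSpace ℝ ι → ℝ≥0∞ := fun l ξ => ‖r ξ l‖ₑ with hΘ
  have hn : Measurable fun η : EuclideanSpace ℝ ι => ENNReal.ofReal ‖η‖ :=
    ENNReal.continuous_ofReal.measurable.comp continuous_norm.measurable
  have hΦm : ∀ k, AEMeasurable (Φ k) volume := fun k => hn.aemeasurable.mul (hq2 k).1.enorm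
  have hΨm : ∀ j, AEMeasurable (Ψ j) volume := fun j => (hp2 j).1.enorm
  have hΘm : ∀ l, AEMeasurable (Θ l) volume := fun l => (aesm_apply hr l).enorm
  calc ∫⁻ ξ, ∑ l, ‖nonlin p q ξ l‖ₑ * ‖r ξ l‖ₑ
      ≤ ∫⁻ ξ, ∑ l, (ENNReal.ofReal (4 * π) * ∑ j, ∑ k, (Φ k ⋆ₗ Ψ j) ξ) * Θ l ξ := by
        refine lintegral_mono fun ξ => Finset.sum_le_sum fun l _ => ?_
        exact mul_le_mul_left (enorm_nonlin_le_of_divFree hdiv hp2 hq2 hqw ξ l) _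
    _ = ENNReal.ofReal (4 * π) * ∑ l, ∑ j, ∑ k, ∫⁻ ξ, Θ l ξ * (Φ k ⋆ₗ Ψ j) ξ := by
        have h1 : ∀ ξ, ∑ l, (ENNReal.ofReal (4 * π) * ∑ j, ∑ k, (Φ k ⋆ₗ Ψ j) ξ) * Θ l ξ =
            ENNReal.ofReal (4 * π) * ∑ l, ∑ j, ∑ k, Θ l ξ * (Φ k ⋆ₗ Ψ j) ξ := fun ξ => by
          symm
          rw [Finset.mul_sum]
          refine Finset.sum_congr rfl fun l _ => ?_
          rw [mul_assoc]
          congr 1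
          rw [Finset.sum_mul]
          refine Finset.sum_congr rfl fun j _ => ?_
          rw [Finset.sum_mul]
          exact Finset.sum_congr rfl fun k _ => mul_comm _ _
        simp_rw [h1]
        rw [lintegral_const_mul' _ _ ENNReal.ofReal_ne_top]
        congr 1
        have hm : ∀ l j k, AEMeasurable (fun ξ => Θ l ξ * (Φ k ⋆ₗ Ψ j) ξ) volume := fun l j k =>
          (hΘm l).mul (aemeasurable_lconvolution (hΦm k) (hΨm j))
        rw [lintegral_finsetSum' _ fun l _ => Finset.aemeasurable_fun_sum _ fun j _ =>
          Finset.aemeasurable_fun_sum _ fun k _ => hm l j k]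
        refine Finset.sum_congr rfl fun l _ => ?_
        rw [lintegral_finsetSum' _ fun j _ => Finset.aemeasurable_fun_sum _ fun k _ => hm l j k]
        refine Finset.sum_congr rfl fun j _ => ?_
        exact lintegral_finsetSum' _ fun k _ => hm l j k
    _ ≤ ENNReal.ofReal (4 * π) * ∑ l, ∑ j, ∑ k, (∫⁻ ξ, Θ l ξ ^ 2) ^ (1 / 2 : ℝ) *
          (∫⁻ ζ, Ψ j ζ ^ 2) ^ (1 / 2 : ℝ) * ∫⁻ η, Φ k η := by
        gcongr with l _ j _ k _
        exact lintegral_mul_lconv_le' (hΦm k) (hΨm j) (hΘm l)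

/-- **Paired nonlinearity, `L¹` on the transporting factor**:
`∫⁻ ∑_l ‖N(p,q)_l‖ ‖r_l‖ ≤ 4π ∑_{l,j,k} ‖r_l‖₂ ‖‖·‖q_k‖₂ ‖p_j‖₁`. [folklore] -/
theorem lintegral_sum_enorm_nonlin_mul_le'
    (hdiv : ∀ᵐ ζ ∂(volume : Measure (EuclideanSpace ℝ ι)), ∑ j, ((ζ j : ℝ) : ℂ) * p ζ j = 0)
    (hp2 : ∀ j, MemLp (fun ζ => p ζ j) 2 volume) (hq2 : ∀ k, MemLp (fun η => q η k) 2 volume)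
    (hqw : ∀ k, MemLp (fun η => ((‖η‖ : ℝ) : ℂ) * q η k) 2 volume)
    (hr : AEStronglyMeasurable r volume) :
    ∫⁻ ξ, ∑ l, ‖nonlin p q ξ l‖ₑ * ‖r ξ l‖ₑ ≤ ENNReal.ofReal (4 * π) * ∑ l, ∑ j, ∑ k,
      (∫⁻ ξ, ‖r ξ l‖ₑ ^ 2) ^ (1 / 2 : ℝ) *
        (∫⁻ η, (ENNReal.ofReal ‖η‖ * ‖q η k‖ₑ) ^ 2) ^ (1 / 2 : ℝ) * ∫⁻ ζ, ‖p ζ j‖ₑ := by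
  set Φ : ι → EuclideanSpace ℝ ι → ℝ≥0∞ := fun k η => ENNReal.ofReal ‖η‖ * ‖q η k‖ₑ with hΦ
  set Ψ : ι → EuclideanSpace ℝ ι → ℝ≥0∞ := fun j ζ => ‖p ζ j‖ₑ with hΨ
  set Θ : ι → EuclideanSpace ℝ ι → ℝ≥0∞ := fun l ξ => ‖r ξ l‖ₑ with hΘ
  have hn : Measurable fun η : EuclideanSpace ℝ ι => ENNReal.ofReal ‖η‖ :=
    ENNReal.continuous_ofReal.measurable.comp continuous_norm.measurable
  have hΦm : ∀ k, AEMeasurable (Φ k) volume := fun k => hn.aemeasurable.mul (hq2 k).1.enorm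
  have hΨm : ∀ j, AEMeasurable (Ψ j) volume := fun j => (hp2 j).1.enorm
  have hΘm : ∀ l, AEMeasurable (Θ l) volume := fun l => (aesm_apply hr l).enorm
  calc ∫⁻ ξ, ∑ l, ‖nonlin p q ξ l‖ₑ * ‖r ξ l‖ₑ
      ≤ ∫⁻ ξ, ∑ l, (ENNReal.ofReal (4 * π) * ∑ j, ∑ k, (Φ k ⋆ₗ Ψ j) ξ) * Θ l ξ := by
        refine lintegral_mono fun ξ => Finset.sum_le_sum fun l _ => ?_
        exact mul_le_mul_left (enorm_nonlin_le_of_divFree hdiv hp2 hq2 hqw ξ l) _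
    _ = ENNReal.ofReal (4 * π) * ∑ l, ∑ j, ∑ k, ∫⁻ ξ, Θ l ξ * (Φ k ⋆ₗ Ψ j) ξ := by
        have h1 : ∀ ξ, ∑ l, (ENNReal.ofReal (4 * π) * ∑ j, ∑ k, (Φ k ⋆ₗ Ψ j) ξ) * Θ l ξ =
            ENNReal.ofReal (4 * π) * ∑ l, ∑ j, ∑ k, Θ l ξ * (Φ k ⋆ₗ Ψ j) ξ := fun ξ => by
          symm
          rw [Finset.mul_sum]
          refine Finset.sum_congr rfl fun l _ => ?_
          rw [mul_assoc]
          congr 1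
          rw [Finset.sum_mul]
          refine Finset.sum_congr rfl fun j _ => ?_
          rw [Finset.sum_mul]
          exact Finset.sum_congr rfl fun k _ => mul_comm _ _
        simp_rw [h1]
        rw [lintegral_const_mul' _ _ ENNReal.ofReal_ne_top]
        congr 1
        have hm : ∀ l j k, AEMeasurable (fun ξ => Θ l ξ * (Φ k ⋆ₗ Ψ j) ξ) volume := fun l j k =>
          (hΘm l).mul (aemeasurable_lconvolution (hΦm k) (hΨm j))
        rw [lintegral_finsetSum' _ fun l _ => Finset.aemeasurable_fun_sum _ fun j _ =>
          Finset.aemeasurable_fun_sum _ fun k _ => hm l j k]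
        refine Finset.sum_congr rfl fun l _ => ?_
        rw [lintegral_finsetSum' _ fun j _ => Finset.aemeasurable_fun_sum _ fun k _ => hm l j k]
        refine Finset.sum_congr rfl fun j _ => ?_
        exact lintegral_finsetSum' _ fun k _ => hm l j k
    _ ≤ ENNReal.ofReal (4 * π) * ∑ l, ∑ j, ∑ k, (∫⁻ ξ, Θ l ξ ^ 2) ^ (1 / 2 : ℝ) *
          (∫⁻ η, Φ k η ^ 2) ^ (1 / 2 : ℝ) * ∫⁻ ζ, Ψ j ζ := by
        gcongr with l _ j _ k _
        exact lintegral_mul_lconv_le (hΦm k) (hΨm j) (hΘm l)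

/-- **The real pairing is dominated by the majorant integral**:
`|Re ∫ ∑_l N(p,q)_l conj r_l| ≤ (∫⁻ ∑_l ‖N(p,q)_l‖‖r_l‖).toReal` when the latter is finite. [folklore] -/
theorem abs_re_integral_sum_nonlin_mul_conj_le {B : ℝ≥0∞} (hB : B ≠ ⊤)
    (h : ∫⁻ ξ, ∑ l, ‖nonlin p q ξ l‖ₑ * ‖r ξ l‖ₑ ≤ B) :
    |(∫ ξ, ∑ l, nonlin p q ξ l * conj (r ξ l)).re| ≤ B.toReal := by
  refine (Complex.abs_re_le_norm _).trans ?_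
  have h1 : ‖∫ ξ, ∑ l, nonlin p q ξ l * conj (r ξ l)‖ₑ ≤ B := by
    refine (enorm_integral_le_lintegral_enorm _).trans ((lintegral_mono fun ξ => ?_).trans h)
    refine (enorm_sum_le _ _).trans (Finset.sum_le_sum fun l _ => ?_)
    rw [enorm_mul, RCLike.enorm_conj]
  calc ‖∫ ξ, ∑ l, nonlin p q ξ l * conj (r ξ l)‖
      = (‖∫ ξ, ∑ l, nonlin p q ξ l * conj (r ξ l)‖ₑ).toReal := (toReal_enorm _).symm
    _ ≤ B.toReal := ENNReal.toReal_mono hB h1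


/-- **Paired nonlinearity with the weight `1 + ‖ξ‖` on the output** (Peetre on the majorant
convolution, then Young): `∫⁻ ∑_l (1+‖ξ‖) ‖N(p,q)_l‖ ‖r_l‖ ≤
8π ∑_{l,j,k} ‖r_l‖₂ (‖(1+‖·‖)p_j‖₂ ‖‖·‖q_k‖₁ + ‖(1+‖·‖)‖·‖q_k‖₂ ‖p_j‖₁)` — the bound that gains the
factor `1/(1+R)` for pairing fields supported off the ball `‖ξ‖ ≤ R` (Majda–Bertozzi's term `R1`
with (3.40), `‖J_εv − v‖₀ ≤ Cε‖v‖₁`). [cite: MajdaBertozzi2002, Lemma 3.7 proof (3.61) with (3.40)] -/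
theorem lintegral_sum_weight_enorm_nonlin_mul_le
    (hdiv : ∀ᵐ ζ ∂(volume : Measure (EuclideanSpace ℝ ι)), ∑ j, ((ζ j : ℝ) : ℂ) * p ζ j = 0)
    (hp2 : ∀ j, MemLp (fun ζ => p ζ j) 2 volume) (hq2 : ∀ k, MemLp (fun η => q η k) 2 volume)
    (hqw : ∀ k, MemLp (fun η => ((‖η‖ : ℝ) : ℂ) * q η k) 2 volume)
    (hr : AEStronglyMeasurable r volume) :
    ∫⁻ ξ, ∑ l, ENNReal.ofReal ((1 + ‖ξ‖) ^ 1) * ‖nonlin p q ξ l‖ₑ * ‖r ξ l‖ₑ ≤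
      ENNReal.ofReal (8 * π) * ∑ l, ∑ j, ∑ k, (∫⁻ ξ, ‖r ξ l‖ₑ ^ 2) ^ (1 / 2 : ℝ) *
        ((∫⁻ ζ, (ENNReal.ofReal ((1 + ‖ζ‖) ^ 1) * ‖p ζ j‖ₑ) ^ 2) ^ (1 / 2 : ℝ) *
            (∫⁻ η, ENNReal.ofReal ‖η‖ * ‖q η k‖ₑ) +
          (∫⁻ η, (ENNReal.ofReal ((1 + ‖η‖) ^ 1) * (ENNReal.ofReal ‖η‖ * ‖q η k‖ₑ)) ^ 2) ^ (1 / 2 : ℝ) *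
            ∫⁻ ζ, ‖p ζ j‖ₑ) := by
  set Φ : ι → EuclideanSpace ℝ ι → ℝ≥0∞ := fun k η => ENNReal.ofReal ‖η‖ * ‖q η k‖ₑ with hΦ
  set Ψ : ι → EuclideanSpace ℝ ι → ℝ≥0∞ := fun j ζ => ‖p ζ j‖ₑ with hΨ
  set Θ : ι → EuclideanSpace ℝ ι → ℝ≥0∞ := fun l ξ => ‖r ξ l‖ₑ with hΘ
  set wΦ : ι → EuclideanSpace ℝ ι → ℝ≥0∞ := fun k η => ENNReal.ofReal ((1 + ‖η‖) ^ 1) * Φ k η with hwΦ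
  set wΨ : ι → EuclideanSpace ℝ ι → ℝ≥0∞ := fun j ζ => ENNReal.ofReal ((1 + ‖ζ‖) ^ 1) * Ψ j ζ with hwΨ
  have hn : Measurable fun η : EuclideanSpace ℝ ι => ENNReal.ofReal ‖η‖ :=
    ENNReal.continuous_ofReal.measurable.comp continuous_norm.measurable
  have hΦm : ∀ k, AEMeasurable (Φ k) volume := fun k => hn.aemeasurable.mul (hq2 k).1.enorm
  have hΨm : ∀ j, AEMeasurable (Ψ j) volume := fun j => (hp2 j).1.enorm
  have hΘm : ∀ l, AEMeasurable (Θ l) volume := fun l => (aesm_apply hr l).enorm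
  have hwΦm : ∀ k, AEMeasurable (wΦ k) volume := fun k =>
    (measurable_ofReal_weight 1).aemeasurable.mul (hΦm k)
  have hwΨm : ∀ j, AEMeasurable (wΨ j) volume := fun j =>
    (measurable_ofReal_weight 1).aemeasurable.mul (hΨm j)
  -- pointwise: Peetre on the majorant convolution
  have hpt : ∀ ξ l, ENNReal.ofReal ((1 + ‖ξ‖) ^ 1) * ‖nonlin p q ξ l‖ₑ * Θ l ξ ≤
      ENNReal.ofReal (8 * π) * ∑ j, ∑ k, (Θ l ξ * (Φ k ⋆ₗ wΨ j) ξ + Θ l ξ * (wΦ k ⋆ₗ Ψ j) ξ) := by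
    intro ξ l
    have h1 := enorm_nonlin_le_of_divFree hdiv hp2 hq2 hqw ξ l
    have h8 : ENNReal.ofReal (8 * π) = ENNReal.ofReal (4 * π) * 2 := by
      rw [show (8 * π : ℝ) = 4 * π * 2 by ring, ENNReal.ofReal_mul' (by norm_num : (0 : ℝ) ≤ 2),
        ENNReal.ofReal_ofNat]
    calc ENNReal.ofReal ((1 + ‖ξ‖) ^ 1) * ‖nonlin p q ξ l‖ₑ * Θ l ξ
        ≤ ENNReal.ofReal ((1 + ‖ξ‖) ^ 1) * (ENNReal.ofReal (4 * π) *
            ∑ j, ∑ k, (Φ k ⋆ₗ Ψ j) ξ) * Θ l ξ := by gcongr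
      _ = ENNReal.ofReal (4 * π) * Θ l ξ * ∑ j, ∑ k, ENNReal.ofReal ((1 + ‖ξ‖) ^ 1) * (Φ k ⋆ₗ Ψ j) ξ := by
          rw [Finset.mul_sum, Finset.mul_sum, Finset.sum_mul, Finset.mul_sum]
          refine Finset.sum_congr rfl fun j _ => ?_
          rw [Finset.mul_sum, Finset.mul_sum, Finset.sum_mul, Finset.mul_sum]
          exact Finset.sum_congr rfl fun k _ => by ring
      _ ≤ ENNReal.ofReal (4 * π) * Θ l ξ * ∑ j, ∑ k, 2 ^ 1 * ((Φ k ⋆ₗ wΨ j) ξ + (wΦ k ⋆ₗ Ψ j) ξ) :=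
          mul_le_mul_right (Finset.sum_le_sum fun j _ => Finset.sum_le_sum fun k _ =>
            weight_mul_lconv_le (hΦm k) (hΨm j) 1 ξ) _
      _ = ENNReal.ofReal (8 * π) * ∑ j, ∑ k, (Θ l ξ * (Φ k ⋆ₗ wΨ j) ξ + Θ l ξ * (wΦ k ⋆ₗ Ψ j) ξ) := by
          rw [h8, Finset.mul_sum, Finset.mul_sum]
          refine Finset.sum_congr rfl fun j _ => ?_
          rw [Finset.mul_sum, Finset.mul_sum]
          exact Finset.sum_congr rfl fun k _ => by ring
  -- integrate
  have hm1 : ∀ l j k, AEMeasurable (fun ξ => Θ l ξ * (Φ k ⋆ₗ wΨ j) ξ) volume := fun l j k =>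
    (hΘm l).mul (aemeasurable_lconvolution (hΦm k) (hwΨm j))
  have hm2 : ∀ l j k, AEMeasurable (fun ξ => Θ l ξ * (wΦ k ⋆ₗ Ψ j) ξ) volume := fun l j k =>
    (hΘm l).mul (aemeasurable_lconvolution (hwΦm k) (hΨm j))
  calc ∫⁻ ξ, ∑ l, ENNReal.ofReal ((1 + ‖ξ‖) ^ 1) * ‖nonlin p q ξ l‖ₑ * ‖r ξ l‖ₑ
      ≤ ∫⁻ ξ, ∑ l, ENNReal.ofReal (8 * π) *
          ∑ j, ∑ k, (Θ l ξ * (Φ k ⋆ₗ wΨ j) ξ + Θ l ξ * (wΦ k ⋆ₗ Ψ j) ξ) :=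
        lintegral_mono fun ξ => Finset.sum_le_sum fun l _ => hpt ξ l
    _ = ENNReal.ofReal (8 * π) * ∑ l, ∑ j, ∑ k,
          ((∫⁻ ξ, Θ l ξ * (Φ k ⋆ₗ wΨ j) ξ) + ∫⁻ ξ, Θ l ξ * (wΦ k ⋆ₗ Ψ j) ξ) := by
        have hml : ∀ l, AEMeasurable (fun ξ => ∑ j, ∑ k,
            (Θ l ξ * (Φ k ⋆ₗ wΨ j) ξ + Θ l ξ * (wΦ k ⋆ₗ Ψ j) ξ)) volume := fun l =>
          Finset.aemeasurable_fun_sum _ fun j _ => Finset.aemeasurable_fun_sum _ fun k _ =>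
            (hm1 l j k).add (hm2 l j k)
        rw [lintegral_finsetSum' _ fun l _ => (hml l).const_mul _, Finset.mul_sum]
        refine Finset.sum_congr rfl fun l _ => ?_
        rw [lintegral_const_mul'' _ (hml l)]
        congr 1
        rw [lintegral_finsetSum' (f := fun j a => ∑ k, (Θ l a * (Φ k ⋆ₗ wΨ j) a + Θ l a * (wΦ k ⋆ₗ Ψ j) a))
          _ fun j _ => Finset.aemeasurable_fun_sum _ fun k _ => (hm1 l j k).add (hm2 l j k)]
        refine Finset.sum_congr rfl fun j _ => ?_
        rw [lintegral_finsetSum' (f := fun k a => Θ l a * (Φ k ⋆ₗ wΨ j) a + Θ l a * (wΦ k ⋆ₗ Ψ j) a)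
          _ fun k _ => (hm1 l j k).add (hm2 l j k)]
        refine Finset.sum_congr rfl fun k _ => ?_
        exact lintegral_add_left' (hm1 l j k) _
    _ ≤ ENNReal.ofReal (8 * π) * ∑ l, ∑ j, ∑ k,
          ((∫⁻ ξ, Θ l ξ ^ 2) ^ (1 / 2 : ℝ) * (∫⁻ ζ, wΨ j ζ ^ 2) ^ (1 / 2 : ℝ) * (∫⁻ η, Φ k η) +
            (∫⁻ ξ, Θ l ξ ^ 2) ^ (1 / 2 : ℝ) * (∫⁻ η, wΦ k η ^ 2) ^ (1 / 2 : ℝ) * ∫⁻ ζ, Ψ j ζ) := by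
        gcongr with l _ j _ k _
        · exact lintegral_mul_lconv_le' (hΦm k) (hwΨm j) (hΘm l)
        · exact lintegral_mul_lconv_le (hwΦm k) (hΨm j) (hΘm l)
    _ = _ := by
        congr 1
        refine Finset.sum_congr rfl fun l _ => Finset.sum_congr rfl fun j _ =>
          Finset.sum_congr rfl fun k _ => ?_
        simp only [hΘ, hwΨ, hwΦ, hΦ, hΨ]
        ring

end Trilinear

/-! ### Continuity and integrability of the paired nonlinearity for `L²` fields -/

section PairedIntegrable

variable {ι : Type*} [Fintype ι] [DecidableEq ι]
variable {p q r : EuclideanSpace ℝ ι → ι → ℂ}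

/-- The nonlinearity of two `L²` fields is continuous in the frequency. [folklore] -/
theorem continuous_nonlin_of_memLp (hp2 : ∀ j, MemLp (fun ζ => p ζ j) 2 volume)
    (hq2 : ∀ k, MemLp (fun η => q η k) 2 volume) (l : ι) :
    Continuous fun ξ => nonlin p q ξ l := by
  simp only [nonlin_apply]
  refine continuous_const.mul (continuous_finsetSum _ fun j _ => continuous_finsetSum _ fun k _ => ?_)
  exact (Complex.continuous_ofReal.comp (continuous_lerayDerivSymbol j k l)).mul
    (continuous_fconv_of_memLp (hp2 j) (hq2 k))

/-- The paired nonlinearity `ξ ↦ ∑_l N(p,q)(ξ)_l conj r_l(ξ)` is integrable as soon as its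
majorant integral is finite. [folklore] -/
theorem integrable_sum_nonlin_mul_conj (hp2 : ∀ j, MemLp (fun ζ => p ζ j) 2 volume)
    (hq2 : ∀ k, MemLp (fun η => q η k) 2 volume) (hr : AEStronglyMeasurable r volume)
    (hfin : ∫⁻ ξ, ∑ l, ‖nonlin p q ξ l‖ₑ * ‖r ξ l‖ₑ < ⊤) :
    Integrable (fun ξ => ∑ l, nonlin p q ξ l * conj (r ξ l)) volume := by
  refine ⟨Finset.aestronglyMeasurable_fun_sum _ fun l _ =>
    (continuous_nonlin_of_memLp hp2 hq2 l).aestronglyMeasurable.mul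
      (Complex.continuous_conj.comp_aestronglyMeasurable (aesm_apply hr l)), ?_⟩
  rw [hasFiniteIntegral_iff_enorm]
  refine lt_of_le_of_lt (lintegral_mono fun ξ => ?_) hfin
  refine (enorm_sum_le _ _).trans (Finset.sum_le_sum fun l _ => ?_)
  rw [enorm_mul, RCLike.enorm_conj]

/-- Triple sums over `Fin 3` of uniformly bounded terms: `∑_{l,j,k} F l j k ≤ 27 b`. [folklore] -/
theorem sum3_le_of_le {F : Fin 3 → Fin 3 → Fin 3 → ℝ≥0∞} {b : ℝ≥0∞} (h : ∀ l j k, F l j k ≤ b) :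
    ∑ l, ∑ j, ∑ k, F l j k ≤ 27 * b := by
  calc ∑ l, ∑ j, ∑ k, F l j k ≤ ∑ _l : Fin 3, ∑ _j : Fin 3, ∑ _k : Fin 3, b :=
        Finset.sum_le_sum fun l _ => Finset.sum_le_sum fun j _ => Finset.sum_le_sum fun k _ => h l j k
    _ = 27 * b := by simp; ring

/-- Triple sums over `Fin 3` of bounded non-negative terms: `∑_{l,j,k} X_l Y_j Z_k ≤ 27 x y z`. [folklore] -/
theorem sum3_mul_le {X Y Z : Fin 3 → ℝ≥0∞} {x y z : ℝ≥0∞} (hX : ∀ l, X l ≤ x) (hY : ∀ j, Y j ≤ y)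
    (hZ : ∀ k, Z k ≤ z) : ∑ l, ∑ j, ∑ k, X l * Y j * Z k ≤ 27 * (x * y * z) := by
  calc ∑ l, ∑ j, ∑ k, X l * Y j * Z k ≤ ∑ _l : Fin 3, ∑ _j : Fin 3, ∑ _k : Fin 3, x * y * z := by
        gcongr with l _ j _ k _
        · exact hX l
        · exact hY j
        · exact hZ k
    _ = 27 * (x * y * z) := by simp; ring

/-- **Finiteness of the majorant integral** when the pairing field is square integrable and the
weighted transported factor is integrable. [folklore] -/
theorem lintegral_sum_enorm_nonlin_mul_lt_top
    (hdiv : ∀ᵐ ζ ∂(volume : Measure (EuclideanSpace ℝ ι)), ∑ j, ((ζ j : ℝ) : ℂ) * p ζ j = 0)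
    (hp2 : ∀ j, MemLp (fun ζ => p ζ j) 2 volume) (hq2 : ∀ k, MemLp (fun η => q η k) 2 volume)
    (hqw : ∀ k, MemLp (fun η => ((‖η‖ : ℝ) : ℂ) * q η k) 2 volume)
    (hq1 : ∀ k, Integrable (fun η => ((‖η‖ : ℝ) : ℂ) * q η k) volume)
    (hr : AEStronglyMeasurable r volume) (hr2 : ∀ l, MemLp (fun ξ => r ξ l) 2 volume) :
    ∫⁻ ξ, ∑ l, ‖nonlin p q ξ l‖ₑ * ‖r ξ l‖ₑ < ⊤ := by
  refine lt_of_le_of_lt (lintegral_sum_enorm_nonlin_mul_le hdiv hp2 hq2 hqw hr) ?_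
  refine ENNReal.mul_lt_top ENNReal.ofReal_lt_top (ENNReal.sum_lt_top.2 fun l _ =>
    ENNReal.sum_lt_top.2 fun j _ => ENNReal.sum_lt_top.2 fun k _ => ?_)
  refine ENNReal.mul_lt_top (ENNReal.mul_lt_top ?_ ?_) ?_
  · rw [lintegral_enorm_sq_rpow_half_eq_eLpNorm]; exact (hr2 l).eLpNorm_lt_top
  · rw [lintegral_enorm_sq_rpow_half_eq_eLpNorm]; exact (hp2 j).eLpNorm_lt_top
  · refine lt_of_le_of_lt (le_of_eq (lintegral_congr fun η => ?_)) (hq1 k).2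
    rw [enorm_mul, ← ofReal_norm (((‖η‖ : ℝ) : ℂ)), Complex.norm_real, Real.norm_of_nonneg (norm_nonneg _)]

end PairedIntegrable

/-! ### Norm bounds for truncated fields, tails of the datum -/

section Pieces

/-- Physical/frequency space `ℝ³`. -/
local notation "ℝ³" => EuclideanSpace ℝ (Fin 3)
/-- The fibre `ℂ³` of the coefficient fields. -/
local notation "ℂ³" => EuclideanSpace ℂ (Fin 3)
/-- The Hilbert space `L²(ℝ³; ℂ³)` of Fourier coefficient fields. -/
local notation "𝓗" => Lp (EuclideanSpace ℂ (Fin 3)) 2 (volume : Measure (EuclideanSpace ℝ (Fin 3)))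

/-- **Derivative of the squared norm along a trajectory**: `d/dt ‖β‖² = 2 Re ⟪β, β'⟫`. [folklore] -/
theorem hasDerivWithinAt_norm_sq {s : Set ℝ} {β : ℝ → 𝓗} {F : 𝓗} {t : ℝ}
    (hβ : HasDerivWithinAt β F s t) :
    HasDerivWithinAt (fun τ => ‖β τ‖ ^ 2) (2 * (⟪β t, F⟫_ℂ).re) s t := by
  have h1 := hβ.inner ℂ hβ
  have h2 := Complex.reCLM.hasFDerivAt.comp_hasDerivWithinAt t h1
  have h3 : (⇑Complex.reCLM ∘ fun τ => ⟪β τ, β τ⟫_ℂ) = fun τ => ‖β τ‖ ^ 2 := by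
    funext τ
    rw [Function.comp_apply, Complex.reCLM_apply]
    have := inner_self_eq_norm_sq (𝕜 := ℂ) (β τ)
    simpa using this
  rw [h3] at h2
  refine h2.congr_deriv ?_
  simp only [Complex.reCLM_apply, Complex.add_re]
  rw [← inner_conj_symm F (β t), Complex.conj_re]
  ring

/-- `(∫⁻ ‖h‖ₑ²)^{1/2} = ‖w‖` for the norm of an `L²` element. [folklore] -/
theorem eLpNorm_coe_eq_ofReal_norm (w : 𝓗) : eLpNorm (w : ℝ³ → ℂ³) 2 volume = ENNReal.ofReal ‖w‖ := by
  rw [Lp.norm_def, ENNReal.ofReal_toReal (Lp.eLpNorm_ne_top w)]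

/-- `‖(χ_ρ w)_l‖₂ ≤ ‖w‖` in the `rpow` form of the trilinear bounds. [folklore] -/
theorem lintegral_truncCoeff_sq_rpow_le (ρ : ℝ) (w : 𝓗) (l : Fin 3) :
    (∫⁻ ξ, ‖truncCoeff ρ w ξ l‖ₑ ^ 2) ^ (1 / 2 : ℝ) ≤ ENNReal.ofReal ‖w‖ := by
  rw [lintegral_enorm_sq_rpow_half_eq_eLpNorm, ← eLpNorm_coe_eq_ofReal_norm, ← Lp.enorm_def]
  exact eLpNorm_truncCoeff_le ρ w l

/-- **Weighted `L²` norms of the truncated field by the `H³` energy**: for an `ℝ≥0∞` weight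
`w ≤ (1+‖·‖)³`, `∫⁻ (w ‖(χ_Rv)_l‖)² ≤ E_3^R(v)`. [folklore] -/
theorem lintegral_weightfun_truncCoeff_sq_le {w : ℝ³ → ℝ≥0∞}
    (hw : ∀ ξ, w ξ ≤ ENNReal.ofReal ((1 + ‖ξ‖) ^ 3)) (R : ℝ) (v : 𝓗) (l : Fin 3) :
    ∫⁻ ξ, (w ξ * ‖truncCoeff R v ξ l‖ₑ) ^ 2 ≤ ENNReal.ofReal (truncEnergy 3 R v) :=
  (lintegral_mono fun ξ => by gcongr; exact hw ξ).trans (lintegral_weight_truncCoeff_sq_le 3 R v l)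

/-- **`L¹` norm of the truncated field by the `H³` energy**: `∫⁻ ‖(χ_Rv)_l‖ ≤ W (E_3^R(v))^{1/2}`
(Cauchy–Schwarz with `(1+‖·‖)^{-2} ∈ L²(ℝ³)`). [folklore] -/
theorem lintegral_enorm_truncCoeff_le (R : ℝ) (v : 𝓗) (l : Fin 3) :
    ∫⁻ ζ, ‖truncCoeff R v ζ l‖ₑ ≤ weightConstENNReal * ENNReal.ofReal (truncEnergy 3 R v) ^ (1 / 2 : ℝ) := by
  have hΦm : AEMeasurable (fun ζ => ‖truncCoeff R v ζ l‖ₑ) volume :=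
    (aesm_apply (aestronglyMeasurable_truncCoeff R v) l).enorm
  have h1 := sq_lintegral_le_weight hΦm 2
  have h2 : ∫⁻ ζ, (ENNReal.ofReal ((1 + ‖ζ‖) ^ 2) * ‖truncCoeff R v ζ l‖ₑ) ^ 2 ≤
      ENNReal.ofReal (truncEnergy 3 R v) :=
    lintegral_weightfun_truncCoeff_sq_le (fun ξ => ENNReal.ofReal_le_ofReal
      (pow_le_pow_right₀ (one_le_one_add_norm ξ) (by norm_num))) R v l
  calc ∫⁻ ζ, ‖truncCoeff R v ζ l‖ₑ ≤ ((∫⁻ ξ : ℝ³, ((ENNReal.ofReal ((1 + ‖ξ‖) ^ 2))⁻¹) ^ 2) *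
        ENNReal.ofReal (truncEnergy 3 R v)) ^ (1 / 2 : ℝ) :=
        energy_le_rpow_half_of_sq_le (h1.trans (mul_le_mul_right h2 _))
    _ = weightConstENNReal * ENNReal.ofReal (truncEnergy 3 R v) ^ (1 / 2 : ℝ) := by
        rw [ENNReal.mul_rpow_of_nonneg _ _ (by norm_num), weightConstENNReal]

/-- **Tail of the datum between two cut-offs, pointwise**: for `0 ≤ R ≤ R'`,
`(1+R)³ |(χ_{R'}a − χ_Ra)_j(ξ)| ≤ (1+‖ξ‖)³ ‖a(ξ)‖`. [folklore] -/
theorem weight_mul_enorm_tail_le {R R' : ℝ} (hR : 0 ≤ R) (hRR' : R ≤ R') (a : 𝓗) (ξ : ℝ³) (j : Fin 3) :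
    ENNReal.ofReal ((1 + R) ^ 3) * ‖truncCoeff R' a ξ j - truncCoeff R a ξ j‖ₑ ≤
      ENNReal.ofReal ((1 + ‖ξ‖) ^ 3) * ‖(a : ℝ³ → ℂ³) ξ‖ₑ := by
  rcases le_or_gt ‖ξ‖ R with h | h
  · rw [truncCoeff_of_le a h, truncCoeff_of_le a (h.trans hRR'), sub_self, enorm_zero, mul_zero]
    exact zero_le
  · have h1 : ‖truncCoeff R' a ξ j - truncCoeff R a ξ j‖ₑ ≤ ‖(a : ℝ³ → ℂ³) ξ‖ₑ := by
      rw [truncCoeff_of_lt a h, sub_zero]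
      rw [← ofReal_norm, ← ofReal_norm]
      exact ENNReal.ofReal_le_ofReal ((norm_truncCoeff_le R' a ξ j).trans (norm_coeff_le a ξ j))
    calc ENNReal.ofReal ((1 + R) ^ 3) * ‖truncCoeff R' a ξ j - truncCoeff R a ξ j‖ₑ
        ≤ ENNReal.ofReal ((1 + ‖ξ‖) ^ 3) * ‖(a : ℝ³ → ℂ³) ξ‖ₑ := by
          gcongr

/-- Weighted tail, pointwise: `(1+R)² ‖ξ‖ |(χ_{R'}a − χ_Ra)_j(ξ)| ≤ (1+‖ξ‖)³ ‖a(ξ)‖`. [folklore] -/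
theorem weight_mul_norm_mul_enorm_tail_le {R R' : ℝ} (hR : 0 ≤ R) (hRR' : R ≤ R') (a : 𝓗) (ξ : ℝ³)
    (j : Fin 3) :
    ENNReal.ofReal ((1 + R) ^ 2) * (ENNReal.ofReal ‖ξ‖ * ‖truncCoeff R' a ξ j - truncCoeff R a ξ j‖ₑ) ≤
      ENNReal.ofReal ((1 + ‖ξ‖) ^ 3) * ‖(a : ℝ³ → ℂ³) ξ‖ₑ := by
  rcases le_or_gt ‖ξ‖ R with h | h
  · rw [truncCoeff_of_le a h, truncCoeff_of_le a (h.trans hRR'), sub_self, enorm_zero, mul_zero, mul_zero]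
    exact zero_le
  · have h1 : ‖truncCoeff R' a ξ j - truncCoeff R a ξ j‖ₑ ≤ ‖(a : ℝ³ → ℂ³) ξ‖ₑ := by
      rw [truncCoeff_of_lt a h, sub_zero, ← ofReal_norm, ← ofReal_norm]
      exact ENNReal.ofReal_le_ofReal ((norm_truncCoeff_le R' a ξ j).trans (norm_coeff_le a ξ j))
    rw [← mul_assoc, ← ENNReal.ofReal_mul (by positivity)]
    gcongr
    calc (1 + R) ^ 2 * ‖ξ‖ ≤ (1 + ‖ξ‖) ^ 2 * (1 + ‖ξ‖) := by
          gcongr; linarith [norm_nonneg ξ]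
      _ = (1 + ‖ξ‖) ^ 3 := by ring

/-- From `c a ≤ b` to `a ≤ c⁻¹ b` in `ℝ≥0∞` (`c ≠ 0, ∞`). [folklore] -/
theorem le_inv_mul_of_mul_le {a b c : ℝ≥0∞} (hc0 : c ≠ 0) (hct : c ≠ ⊤) (h : c * a ≤ b) : a ≤ c⁻¹ * b :=
  calc a = c⁻¹ * (c * a) := by rw [← mul_assoc, ENNReal.inv_mul_cancel hc0 hct, one_mul]
    _ ≤ c⁻¹ * b := mul_le_mul_right h _

/-- **Tails of the datum in `L²`**: with `M = (∫⁻ ((1+‖ξ‖)³‖a(ξ)‖)²)^{1/2}`,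
`‖(χ_{R'}a − χ_Ra)_j‖₂ ≤ M / (1+R)³`. [cite: MajdaBertozzi2002, Lemma 3.5 (3.40) p. 99] -/
theorem lintegral_tail_sq_rpow_le {R R' : ℝ} (hR : 0 ≤ R) (hRR' : R ≤ R') (a : 𝓗) (j : Fin 3) :
    (∫⁻ ξ, ‖truncCoeff R' a ξ j - truncCoeff R a ξ j‖ₑ ^ 2) ^ (1 / 2 : ℝ) ≤
      (ENNReal.ofReal ((1 + R) ^ 3))⁻¹ *
        (∫⁻ ξ, (ENNReal.ofReal ((1 + ‖ξ‖) ^ 3) * ‖(a : ℝ³ → ℂ³) ξ‖ₑ) ^ 2) ^ (1 / 2 : ℝ) := by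
  have hc0 : ENNReal.ofReal ((1 + R) ^ 3) ≠ 0 := (ENNReal.ofReal_pos.2 (by positivity)).ne'
  have hct : ENNReal.ofReal ((1 + R) ^ 3) ≠ ⊤ := ENNReal.ofReal_ne_top
  have hpt : ∀ ξ, ‖truncCoeff R' a ξ j - truncCoeff R a ξ j‖ₑ ≤ (ENNReal.ofReal ((1 + R) ^ 3))⁻¹ *
      (ENNReal.ofReal ((1 + ‖ξ‖) ^ 3) * ‖(a : ℝ³ → ℂ³) ξ‖ₑ) := fun ξ => by
    exact le_inv_mul_of_mul_le hc0 hct (weight_mul_enorm_tail_le hR hRR' a ξ j)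
  calc (∫⁻ ξ, ‖truncCoeff R' a ξ j - truncCoeff R a ξ j‖ₑ ^ 2) ^ (1 / 2 : ℝ)
      ≤ (∫⁻ ξ, ((ENNReal.ofReal ((1 + R) ^ 3))⁻¹ *
          (ENNReal.ofReal ((1 + ‖ξ‖) ^ 3) * ‖(a : ℝ³ → ℂ³) ξ‖ₑ)) ^ 2) ^ (1 / 2 : ℝ) :=
        ENNReal.rpow_le_rpow (lintegral_mono fun ξ => pow_le_pow_left₀ bot_le (hpt ξ) 2) (by norm_num)
    _ = _ := by
        simp_rw [mul_pow]
        rw [lintegral_const_mul' _ _ (ENNReal.pow_ne_top (ENNReal.inv_ne_top.2 hc0)),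
          ENNReal.mul_rpow_of_nonneg _ _ (by norm_num), energy_sq_rpow_half]

/-- **Weighted tails of the datum in `L²`**: `‖‖·‖(χ_{R'}a − χ_Ra)_j‖₂ ≤ M / (1+R)²`. [cite: MajdaBertozzi2002, Lemma 3.5 (3.40) p. 99] -/
theorem lintegral_norm_mul_tail_sq_rpow_le {R R' : ℝ} (hR : 0 ≤ R) (hRR' : R ≤ R') (a : 𝓗) (j : Fin 3) :
    (∫⁻ ξ, (ENNReal.ofReal ‖ξ‖ * ‖truncCoeff R' a ξ j - truncCoeff R a ξ j‖ₑ) ^ 2) ^ (1 / 2 : ℝ) ≤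
      (ENNReal.ofReal ((1 + R) ^ 2))⁻¹ *
        (∫⁻ ξ, (ENNReal.ofReal ((1 + ‖ξ‖) ^ 3) * ‖(a : ℝ³ → ℂ³) ξ‖ₑ) ^ 2) ^ (1 / 2 : ℝ) := by
  have hc0 : ENNReal.ofReal ((1 + R) ^ 2) ≠ 0 := (ENNReal.ofReal_pos.2 (by positivity)).ne'
  have hct : ENNReal.ofReal ((1 + R) ^ 2) ≠ ⊤ := ENNReal.ofReal_ne_top
  have hpt : ∀ ξ, ENNReal.ofReal ‖ξ‖ * ‖truncCoeff R' a ξ j - truncCoeff R a ξ j‖ₑ ≤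
      (ENNReal.ofReal ((1 + R) ^ 2))⁻¹ * (ENNReal.ofReal ((1 + ‖ξ‖) ^ 3) * ‖(a : ℝ³ → ℂ³) ξ‖ₑ) := fun ξ => by
    exact le_inv_mul_of_mul_le hc0 hct (weight_mul_norm_mul_enorm_tail_le hR hRR' a ξ j)
  calc (∫⁻ ξ, (ENNReal.ofReal ‖ξ‖ * ‖truncCoeff R' a ξ j - truncCoeff R a ξ j‖ₑ) ^ 2) ^ (1 / 2 : ℝ)
      ≤ (∫⁻ ξ, ((ENNReal.ofReal ((1 + R) ^ 2))⁻¹ *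
          (ENNReal.ofReal ((1 + ‖ξ‖) ^ 3) * ‖(a : ℝ³ → ℂ³) ξ‖ₑ)) ^ 2) ^ (1 / 2 : ℝ) :=
        ENNReal.rpow_le_rpow (lintegral_mono fun ξ => pow_le_pow_left₀ bot_le (hpt ξ) 2) (by norm_num)
    _ = _ := by
        simp_rw [mul_pow]
        rw [lintegral_const_mul' _ _ (ENNReal.pow_ne_top (ENNReal.inv_ne_top.2 hc0)),
          ENNReal.mul_rpow_of_nonneg _ _ (by norm_num), energy_sq_rpow_half]

/-- The pairing field of the cut-off difference: `‖((χ_{R'}−χ_R)/(1+‖·‖)) w_l‖₂ ≤ ‖w‖/(1+R)`. [folklore] -/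
theorem lintegral_cutoff_diff_div_sq_rpow_le {R R' : ℝ} (hR : 0 ≤ R) (hRR' : R ≤ R') (w : 𝓗) (l : Fin 3) :
    (∫⁻ ξ, ‖(((cutoff R' ξ - cutoff R ξ) / (1 + ‖ξ‖) : ℝ) : ℂ) * coeff w ξ l‖ₑ ^ 2) ^ (1 / 2 : ℝ) ≤
      (ENNReal.ofReal (1 + R))⁻¹ * ENNReal.ofReal ‖w‖ := by
  have hc0 : ENNReal.ofReal (1 + R) ≠ 0 := (ENNReal.ofReal_pos.2 (by positivity)).ne'
  have hct : ENNReal.ofReal (1 + R) ≠ ⊤ := ENNReal.ofReal_ne_top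
  have hpt : ∀ ξ, ‖(((cutoff R' ξ - cutoff R ξ) / (1 + ‖ξ‖) : ℝ) : ℂ) * coeff w ξ l‖ₑ ≤
      (ENNReal.ofReal (1 + R))⁻¹ * ‖(w : ℝ³ → ℂ³) ξ‖ₑ := fun ξ => by
    refine le_inv_mul_of_mul_le hc0 hct ?_
    rw [enorm_mul, ← ofReal_norm (((_ : ℝ) : ℂ)),
      Complex.norm_real, Real.norm_eq_abs, ← mul_assoc, ← ENNReal.ofReal_mul (by positivity)]
    rcases le_or_gt ‖ξ‖ R with h | h
    · rw [cutoff_of_le h, cutoff_of_le (h.trans hRR'), sub_self, zero_div, abs_zero, mul_zero,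
        ENNReal.ofReal_zero, zero_mul]
      exact zero_le
    · calc ENNReal.ofReal ((1 + R) * |(cutoff R' ξ - cutoff R ξ) / (1 + ‖ξ‖)|) * ‖coeff w ξ l‖ₑ
          ≤ ENNReal.ofReal 1 * ‖(w : ℝ³ → ℂ³) ξ‖ₑ := by
            gcongr
            · rw [abs_div, abs_of_pos (by positivity : (0 : ℝ) < 1 + ‖ξ‖), ← mul_div_assoc,
                div_le_one (by positivity)]
              have : |cutoff R' ξ - cutoff R ξ| ≤ 1 := by
                rw [abs_le]; constructor <;>
                  linarith [cutoff_nonneg R ξ, cutoff_le_one R ξ, cutoff_nonneg R' ξ, cutoff_le_one R' ξ]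
              nlinarith [this, h.le]
            · rw [← ofReal_norm, ← ofReal_norm]
              exact ENNReal.ofReal_le_ofReal (norm_coeff_le w ξ l)
        _ = ‖(w : ℝ³ → ℂ³) ξ‖ₑ := by rw [ENNReal.ofReal_one, one_mul]
  calc (∫⁻ ξ, ‖(((cutoff R' ξ - cutoff R ξ) / (1 + ‖ξ‖) : ℝ) : ℂ) * coeff w ξ l‖ₑ ^ 2) ^ (1 / 2 : ℝ)
      ≤ (∫⁻ ξ, ((ENNReal.ofReal (1 + R))⁻¹ * ‖(w : ℝ³ → ℂ³) ξ‖ₑ) ^ 2) ^ (1 / 2 : ℝ) :=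
        ENNReal.rpow_le_rpow (lintegral_mono fun ξ => pow_le_pow_left₀ bot_le (hpt ξ) 2) (by norm_num)
    _ = (ENNReal.ofReal (1 + R))⁻¹ * ENNReal.ofReal ‖w‖ := by
        simp_rw [mul_pow]
        rw [lintegral_const_mul' _ _ (ENNReal.pow_ne_top (ENNReal.inv_ne_top.2 hc0)),
          ENNReal.mul_rpow_of_nonneg _ _ (by norm_num), energy_sq_rpow_half,
          lintegral_enorm_sq_rpow_half_eq_eLpNorm, eLpNorm_coe_eq_ofReal_norm]

end Pieces

/-! ### Real-valued forms of the trilinear bounds on `Fin 3` -/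

section RealBounds

variable {p q r : EuclideanSpace ℝ (Fin 3) → Fin 3 → ℂ}

/-- **Real bound, `L¹` on the weighted transported factor**: if `‖r_l‖₂ ≤ x`, `‖p_j‖₂ ≤ y`,
`‖‖·‖q_k‖₁ ≤ z`, then `|Re ∫ ∑_l N(p,q)_l conj r_l| ≤ 4π·27·xyz` and the paired integrand is
integrable. [folklore] -/
theorem abs_re_pairing_le_of_bounds
    (hdiv : ∀ᵐ ζ ∂(volume : Measure (EuclideanSpace ℝ (Fin 3))), ∑ j, ((ζ j : ℝ) : ℂ) * p ζ j = 0)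
    (hp2 : ∀ j, MemLp (fun ζ => p ζ j) 2 volume) (hq2 : ∀ k, MemLp (fun η => q η k) 2 volume)
    (hqw : ∀ k, MemLp (fun η => ((‖η‖ : ℝ) : ℂ) * q η k) 2 volume)
    (hr : AEStronglyMeasurable r volume) {x y z : ℝ} (hx : 0 ≤ x) (hy : 0 ≤ y) (hz : 0 ≤ z)
    (hX : ∀ l, (∫⁻ ξ, ‖r ξ l‖ₑ ^ 2) ^ (1 / 2 : ℝ) ≤ ENNReal.ofReal x)
    (hY : ∀ j, (∫⁻ ζ, ‖p ζ j‖ₑ ^ 2) ^ (1 / 2 : ℝ) ≤ ENNReal.ofReal y)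
    (hZ : ∀ k, ∫⁻ η, ENNReal.ofReal ‖η‖ * ‖q η k‖ₑ ≤ ENNReal.ofReal z) :
    |(∫ ξ, ∑ l, nonlin p q ξ l * conj (r ξ l)).re| ≤ 4 * π * (27 * (x * y * z)) ∧
      Integrable (fun ξ => ∑ l, nonlin p q ξ l * conj (r ξ l)) volume := by
  have h1 := lintegral_sum_enorm_nonlin_mul_le hdiv hp2 hq2 hqw hr
  have h2 : ∑ l, ∑ j, ∑ k, (∫⁻ ξ, ‖r ξ l‖ₑ ^ 2) ^ (1 / 2 : ℝ) * (∫⁻ ζ, ‖p ζ j‖ₑ ^ 2) ^ (1 / 2 : ℝ) *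
      (∫⁻ η, ENNReal.ofReal ‖η‖ * ‖q η k‖ₑ) ≤ 27 * (ENNReal.ofReal x * ENNReal.ofReal y * ENNReal.ofReal z) :=
    sum3_mul_le hX hY hZ
  have hB : ∫⁻ ξ, ∑ l, ‖nonlin p q ξ l‖ₑ * ‖r ξ l‖ₑ ≤ ENNReal.ofReal (4 * π * (27 * (x * y * z))) := by
    refine (h1.trans (mul_le_mul_right h2 _)).trans (le_of_eq ?_)
    rw [← ENNReal.ofReal_mul hx, ← ENNReal.ofReal_mul (by positivity),
      show (27 : ℝ≥0∞) = ENNReal.ofReal 27 from (ENNReal.ofReal_ofNat 27).symm,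
      ← ENNReal.ofReal_mul (by norm_num), ← ENNReal.ofReal_mul (by positivity)]
  refine ⟨?_, integrable_sum_nonlin_mul_conj hp2 hq2 hr (lt_of_le_of_lt hB ENNReal.ofReal_lt_top)⟩
  have h := abs_re_integral_sum_nonlin_mul_conj_le ENNReal.ofReal_ne_top hB
  rwa [ENNReal.toReal_ofReal (by positivity)] at h

/-- **Real bound, `L¹` on the transporting factor**: if `‖r_l‖₂ ≤ x`, `‖‖·‖q_k‖₂ ≤ y`, `‖p_j‖₁ ≤ z`,
then `|Re ∫ ∑_l N(p,q)_l conj r_l| ≤ 4π·27·xyz` and the paired integrand is integrable. [folklore] -/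
theorem abs_re_pairing_le_of_bounds'
    (hdiv : ∀ᵐ ζ ∂(volume : Measure (EuclideanSpace ℝ (Fin 3))), ∑ j, ((ζ j : ℝ) : ℂ) * p ζ j = 0)
    (hp2 : ∀ j, MemLp (fun ζ => p ζ j) 2 volume) (hq2 : ∀ k, MemLp (fun η => q η k) 2 volume)
    (hqw : ∀ k, MemLp (fun η => ((‖η‖ : ℝ) : ℂ) * q η k) 2 volume)
    (hr : AEStronglyMeasurable r volume) {x y z : ℝ} (hx : 0 ≤ x) (hy : 0 ≤ y) (hz : 0 ≤ z)
    (hX : ∀ l, (∫⁻ ξ, ‖r ξ l‖ₑ ^ 2) ^ (1 / 2 : ℝ) ≤ ENNReal.ofReal x)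
    (hY : ∀ k, (∫⁻ η, (ENNReal.ofReal ‖η‖ * ‖q η k‖ₑ) ^ 2) ^ (1 / 2 : ℝ) ≤ ENNReal.ofReal y)
    (hZ : ∀ j, ∫⁻ ζ, ‖p ζ j‖ₑ ≤ ENNReal.ofReal z) :
    |(∫ ξ, ∑ l, nonlin p q ξ l * conj (r ξ l)).re| ≤ 4 * π * (27 * (x * y * z)) ∧
      Integrable (fun ξ => ∑ l, nonlin p q ξ l * conj (r ξ l)) volume := by
  have h1 := lintegral_sum_enorm_nonlin_mul_le' hdiv hp2 hq2 hqw hr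
  have h2 : ∑ l, ∑ j, ∑ k, (∫⁻ ξ, ‖r ξ l‖ₑ ^ 2) ^ (1 / 2 : ℝ) *
      (∫⁻ η, (ENNReal.ofReal ‖η‖ * ‖q η k‖ₑ) ^ 2) ^ (1 / 2 : ℝ) * (∫⁻ ζ, ‖p ζ j‖ₑ) ≤
      27 * (ENNReal.ofReal x * ENNReal.ofReal y * ENNReal.ofReal z) :=
    sum3_le_of_le fun l j k => by
      gcongr
      · exact hX l
      · exact hY k
      · exact hZ j
  have hB : ∫⁻ ξ, ∑ l, ‖nonlin p q ξ l‖ₑ * ‖r ξ l‖ₑ ≤ ENNReal.ofReal (4 * π * (27 * (x * y * z))) := by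
    refine (h1.trans (mul_le_mul_right h2 _)).trans (le_of_eq ?_)
    rw [← ENNReal.ofReal_mul hx, ← ENNReal.ofReal_mul (by positivity),
      show (27 : ℝ≥0∞) = ENNReal.ofReal 27 from (ENNReal.ofReal_ofNat 27).symm,
      ← ENNReal.ofReal_mul (by norm_num), ← ENNReal.ofReal_mul (by positivity)]
  refine ⟨?_, integrable_sum_nonlin_mul_conj hp2 hq2 hr (lt_of_le_of_lt hB ENNReal.ofReal_lt_top)⟩
  have h := abs_re_integral_sum_nonlin_mul_conj_le ENNReal.ofReal_ne_top hB
  rwa [ENNReal.toReal_ofReal (by positivity)] at h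

/-- **Real bound for the weighted pairing** `∫ ∑_l (1+‖ξ‖) N(p,q)_l conj r_l`: with
`‖r_l‖₂ ≤ x`, `‖(1+‖·‖)p_j‖₂ ≤ y₁`, `‖‖·‖q_k‖₁ ≤ z₁`, `‖(1+‖·‖)‖·‖q_k‖₂ ≤ y₂`, `‖p_j‖₁ ≤ z₂`,
`|Re ∫ ∑_l (1+‖ξ‖) N(p,q)_l conj r_l| ≤ 8π·27·x(y₁z₁ + y₂z₂)`, and the weighted integrand is integrable.
[folklore] -/
theorem abs_re_weight_pairing_le_of_bounds
    (hdiv : ∀ᵐ ζ ∂(volume : Measure (EuclideanSpace ℝ (Fin 3))), ∑ j, ((ζ j : ℝ) : ℂ) * p ζ j = 0)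
    (hp2 : ∀ j, MemLp (fun ζ => p ζ j) 2 volume) (hq2 : ∀ k, MemLp (fun η => q η k) 2 volume)
    (hqw : ∀ k, MemLp (fun η => ((‖η‖ : ℝ) : ℂ) * q η k) 2 volume)
    (hr : AEStronglyMeasurable r volume) {x y₁ z₁ y₂ z₂ : ℝ} (hx : 0 ≤ x) (hy₁ : 0 ≤ y₁)
    (hz₁ : 0 ≤ z₁) (hy₂ : 0 ≤ y₂) (hz₂ : 0 ≤ z₂)
    (hX : ∀ l, (∫⁻ ξ, ‖r ξ l‖ₑ ^ 2) ^ (1 / 2 : ℝ) ≤ ENNReal.ofReal x)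
    (hY₁ : ∀ j, (∫⁻ ζ, (ENNReal.ofReal ((1 + ‖ζ‖) ^ 1) * ‖p ζ j‖ₑ) ^ 2) ^ (1 / 2 : ℝ) ≤ ENNReal.ofReal y₁)
    (hZ₁ : ∀ k, ∫⁻ η, ENNReal.ofReal ‖η‖ * ‖q η k‖ₑ ≤ ENNReal.ofReal z₁)
    (hY₂ : ∀ k, (∫⁻ η, (ENNReal.ofReal ((1 + ‖η‖) ^ 1) * (ENNReal.ofReal ‖η‖ * ‖q η k‖ₑ)) ^ 2) ^
      (1 / 2 : ℝ) ≤ ENNReal.ofReal y₂)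
    (hZ₂ : ∀ j, ∫⁻ ζ, ‖p ζ j‖ₑ ≤ ENNReal.ofReal z₂) :
    |(∫ ξ, ∑ l, (((1 + ‖ξ‖ : ℝ)) : ℂ) * (nonlin p q ξ l * conj (r ξ l))).re| ≤
        8 * π * (27 * (x * (y₁ * z₁ + y₂ * z₂))) ∧
      Integrable (fun ξ => ∑ l, (((1 + ‖ξ‖ : ℝ)) : ℂ) * (nonlin p q ξ l * conj (r ξ l))) volume := by
  have h1 := lintegral_sum_weight_enorm_nonlin_mul_le hdiv hp2 hq2 hqw hr
  have h2 : ∑ l, ∑ j, ∑ k, (∫⁻ ξ, ‖r ξ l‖ₑ ^ 2) ^ (1 / 2 : ℝ) *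
      ((∫⁻ ζ, (ENNReal.ofReal ((1 + ‖ζ‖) ^ 1) * ‖p ζ j‖ₑ) ^ 2) ^ (1 / 2 : ℝ) *
          (∫⁻ η, ENNReal.ofReal ‖η‖ * ‖q η k‖ₑ) +
        (∫⁻ η, (ENNReal.ofReal ((1 + ‖η‖) ^ 1) * (ENNReal.ofReal ‖η‖ * ‖q η k‖ₑ)) ^ 2) ^ (1 / 2 : ℝ) *
          ∫⁻ ζ, ‖p ζ j‖ₑ) ≤
      27 * (ENNReal.ofReal x * (ENNReal.ofReal y₁ * ENNReal.ofReal z₁ + ENNReal.ofReal y₂ * ENNReal.ofReal z₂)) :=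
    sum3_le_of_le fun l j k => by
      gcongr
      · exact hX l
      · exact hY₁ j
      · exact hZ₁ k
      · exact hY₂ k
      · exact hZ₂ j
  have hB : ∫⁻ ξ, ∑ l, ENNReal.ofReal ((1 + ‖ξ‖) ^ 1) * ‖nonlin p q ξ l‖ₑ * ‖r ξ l‖ₑ ≤
      ENNReal.ofReal (8 * π * (27 * (x * (y₁ * z₁ + y₂ * z₂)))) := by
    refine (h1.trans (mul_le_mul_right h2 _)).trans (le_of_eq ?_)
    rw [← ENNReal.ofReal_mul hy₁, ← ENNReal.ofReal_mul hy₂, ← ENNReal.ofReal_add (by positivity)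
      (by positivity), ← ENNReal.ofReal_mul hx,
      show (27 : ℝ≥0∞) = ENNReal.ofReal 27 from (ENNReal.ofReal_ofNat 27).symm,
      ← ENNReal.ofReal_mul (by norm_num), ← ENNReal.ofReal_mul (by positivity)]
  -- the weighted integrand and its majorant
  have hmaj : ∀ ξ, ‖∑ l, (((1 + ‖ξ‖ : ℝ)) : ℂ) * (nonlin p q ξ l * conj (r ξ l))‖ₑ ≤
      ∑ l, ENNReal.ofReal ((1 + ‖ξ‖) ^ 1) * ‖nonlin p q ξ l‖ₑ * ‖r ξ l‖ₑ := fun ξ => by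
    refine (enorm_sum_le _ _).trans (Finset.sum_le_sum fun l _ => le_of_eq ?_)
    rw [enorm_ofReal_mul (by positivity), enorm_mul, RCLike.enorm_conj, pow_one, mul_assoc]
  refine ⟨?_, ?_⟩
  · refine (Complex.abs_re_le_norm _).trans ?_
    have h3 : ‖∫ ξ, ∑ l, (((1 + ‖ξ‖ : ℝ)) : ℂ) * (nonlin p q ξ l * conj (r ξ l))‖ₑ ≤
        ENNReal.ofReal (8 * π * (27 * (x * (y₁ * z₁ + y₂ * z₂)))) :=
      (enorm_integral_le_lintegral_enorm _).trans ((lintegral_mono hmaj).trans hB)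
    calc ‖∫ ξ, ∑ l, (((1 + ‖ξ‖ : ℝ)) : ℂ) * (nonlin p q ξ l * conj (r ξ l))‖
        = (‖∫ ξ, ∑ l, (((1 + ‖ξ‖ : ℝ)) : ℂ) * (nonlin p q ξ l * conj (r ξ l))‖ₑ).toReal :=
          (toReal_enorm _).symm
      _ ≤ (ENNReal.ofReal (8 * π * (27 * (x * (y₁ * z₁ + y₂ * z₂))))).toReal := ENNReal.toReal_mono
          ENNReal.ofReal_ne_top h3
      _ = _ := ENNReal.toReal_ofReal (by positivity)
  · refine ⟨Finset.aestronglyMeasurable_fun_sum _ fun l _ =>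
      ((Complex.continuous_ofReal.comp (by fun_prop)).aestronglyMeasurable).mul
        ((continuous_nonlin_of_memLp hp2 hq2 l).aestronglyMeasurable.mul
          (Complex.continuous_conj.comp_aestronglyMeasurable (aesm_apply hr l))), ?_⟩
    rw [hasFiniteIntegral_iff_enorm]
    exact lt_of_le_of_lt ((lintegral_mono hmaj).trans hB) ENNReal.ofReal_lt_top

end RealBounds

/-! ### The differential inequality for the difference of two Galerkin solutions -/

section Difference

/-- Physical/frequency space `ℝ³`. -/
local notation "ℝ³" => EuclideanSpace ℝ (Fin 3)
/-- The fibre `ℂ³` of the coefficient fields. -/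
local notation "ℂ³" => EuclideanSpace ℂ (Fin 3)
/-- The Hilbert space `L²(ℝ³; ℂ³)` of Fourier coefficient fields. -/
local notation "𝓗" => Lp (EuclideanSpace ℂ (Fin 3)) 2 (volume : Measure (EuclideanSpace ℝ (Fin 3)))

/-- The inviscid Galerkin field is `-B_R(v, v)`. [folklore] -/
theorem coe_galerkinField_zero (R : ℝ) (v : symSubspace) :
    (galerkinField 0 R v : 𝓗) = -galerkinNonlin R (v : 𝓗) (v : 𝓗) := by
  rw [coe_galerkinField, zero_smul, neg_zero, zero_sub]

/-- **The pairing of the difference of two inviscid Galerkin fields** with the difference of the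
states, in coefficients: `⟪u − v, F_R(u) − F_{R'}(v)⟫ = I' − I` with
`I = ∫ ∑_l N(χ_Ru, χ_Ru)_l conj (χ_R(u−v))_l`, `I' = ∫ ∑_l N(χ_{R'}v, χ_{R'}v)_l conj (χ_{R'}(u−v))_l`.
[folklore] -/
theorem inner_sub_galerkinField_zero (R R' : ℝ) (u v : symSubspace) :
    ⟪(u : 𝓗) - (v : 𝓗), (galerkinField 0 R u : 𝓗) - (galerkinField 0 R' v : 𝓗)⟫_ℂ =
      (∫ ξ, ∑ l, nonlin (truncCoeff R' (v : 𝓗)) (truncCoeff R' (v : 𝓗)) ξ l *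
          conj (truncCoeff R' ((u : 𝓗) - (v : 𝓗)) ξ l)) -
        ∫ ξ, ∑ l, nonlin (truncCoeff R (u : 𝓗)) (truncCoeff R (u : 𝓗)) ξ l *
          conj (truncCoeff R ((u : 𝓗) - (v : 𝓗)) ξ l) := by
  rw [coe_galerkinField_zero, coe_galerkinField_zero, inner_sub_right, inner_neg_right, inner_neg_right,
    inner_galerkinNonlin, inner_galerkinNonlin]
  ring

variable {A R R' : ℝ}

/-- **The tail identity**: off the small ball the state at radius `R` equals the datum, so the
difference of the truncated states is the datum tail minus the truncated difference:
`χ_{R'}v − χ_Ru = (χ_{R'} − χ_R)a − χ_{R'}(u − v)` a.e. (`u = a` a.e. on `‖ξ‖ > R`, `R ≤ R'`).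
[folklore] -/
theorem truncCoeff_sub_truncCoeff_ae (hRR' : R ≤ R') {a u v : 𝓗}
    (hua : ∀ᵐ ξ ∂(volume : Measure ℝ³), R < ‖ξ‖ → (u : ℝ³ → ℂ³) ξ = (a : ℝ³ → ℂ³) ξ) :
    ∀ᵐ ξ ∂(volume : Measure ℝ³), (fun j => truncCoeff R' v ξ j - truncCoeff R u ξ j) =
      fun j => (truncCoeff R' a ξ j - truncCoeff R a ξ j) - truncCoeff R' (u - v) ξ j := by
  filter_upwards [hua, coeff_sub_ae u v] with ξ h1 h2
  funext j
  rcases le_or_gt ‖ξ‖ R with h | h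
  · rw [truncCoeff_of_le v (h.trans hRR'), truncCoeff_of_le u h, truncCoeff_of_le a (h.trans hRR'),
      truncCoeff_of_le a h, truncCoeff_of_le (u - v) (h.trans hRR'), h2 j]
    ring
  · have hu : coeff u ξ j = coeff a ξ j := by rw [coeff_apply, coeff_apply, h1 h]
    simp only [truncCoeff_apply, cutoff_of_lt h, h2 j, hu, Complex.ofReal_zero]
    ring

/-- Standard facts about the truncated field of an `L²` element used by the trilinear bounds:
square integrability, weighted square integrability and weighted integrability of the components.
[folklore] -/
theorem truncCoeff_facts (ρ : ℝ) (v : 𝓗) :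
    (∀ l, MemLp (fun ξ => truncCoeff ρ v ξ l) 2 volume) ∧
      (∀ l, MemLp (fun η => ((‖η‖ : ℝ) : ℂ) * truncCoeff ρ v η l) 2 volume) ∧
      (∀ l, Integrable (fun η => ((‖η‖ : ℝ) : ℂ) * truncCoeff ρ v η l) volume) :=
  ⟨memLp_truncCoeff ρ v, fun l => memLp_weight_mul_truncCoeff continuous_norm
    (fun ξ hξ => by rw [abs_norm]; exact hξ) v l,
    fun l => integrable_weight_mul_truncCoeff continuous_norm v l⟩

/-- `(E_3^R)^{1/2} ≤ 2(A+1)^{1/2}` in `ℝ≥0∞` from `E_3^R ≤ 4(A+1)`. [folklore] -/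
theorem ofReal_rpow_half_le_of_le {E A : ℝ} (hE : E ≤ 4 * (A + 1)) (hE0 : 0 ≤ E) :
    ENNReal.ofReal E ^ (1 / 2 : ℝ) ≤ ENNReal.ofReal (2 * Real.sqrt (A + 1)) := by
  rw [ENNReal.ofReal_rpow_of_nonneg hE0 (by norm_num), ← Real.sqrt_eq_rpow]
  refine ENNReal.ofReal_le_ofReal ?_
  calc Real.sqrt E ≤ Real.sqrt (4 * (A + 1)) := Real.sqrt_le_sqrt hE
    _ = 2 * Real.sqrt (A + 1) := by
        rw [Real.sqrt_mul (by norm_num), show (4 : ℝ) = 2 ^ 2 by norm_num, Real.sqrt_sq (by norm_num)]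

/-- The real arithmetic closing the differential inequality: with the four trilinear bounds in
the shape produced by `abs_re_pairing_le_of_bounds(')`/`abs_re_weight_pairing_le_of_bounds`,
`2(J₁ − J₂ + J₃ + J₅) ≤ (432πWS + 1)‖w‖² + (2160πWS²)²/(1+R)²` (AM–GM on the linear terms). [folklore] -/
theorem cauchy_arith {P W S n R J₁ J₂ J₃ J₅ : ℝ} (hP : 0 ≤ P) (hW : 0 ≤ W) (hn : 0 ≤ n) (hR : 0 ≤ R)
    (h1 : |J₁| ≤ 4 * P * (27 * (n * (S / (1 + R) ^ 3) * (W * (2 * S)))))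
    (h2 : |J₂| ≤ 4 * P * (27 * (n * n * (W * (2 * S)))))
    (h3 : |J₃| ≤ 4 * P * (27 * (n * (S / (1 + R) ^ 2) * (W * (2 * S)))))
    (h5 : |J₅| ≤ 8 * P * (27 * (n / (1 + R) * (2 * S * (W * (2 * S)) + 2 * S * (W * (2 * S)))))) :
    2 * (J₁ - J₂ + J₃ + J₅) ≤ (432 * P * W * S + 1) * n ^ 2 + (2160 * P * W * S ^ 2) ^ 2 / (1 + R) ^ 2 := by
  have hR1 : 1 ≤ 1 + R := by linarith
  have hq3 : 1 / (1 + R) ^ 3 ≤ 1 / (1 + R) :=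
    one_div_le_one_div_of_le (by positivity) (le_self_pow₀ hR1 (by norm_num))
  have hq2 : 1 / (1 + R) ^ 2 ≤ 1 / (1 + R) :=
    one_div_le_one_div_of_le (by positivity) (le_self_pow₀ hR1 (by norm_num))
  have hK : 0 ≤ 216 * P * W * S ^ 2 * n := by positivity
  have hb1 : J₁ ≤ 216 * P * W * S ^ 2 * n * (1 / (1 + R)) := by
    refine (le_abs_self _).trans (h1.trans ?_)
    calc 4 * P * (27 * (n * (S / (1 + R) ^ 3) * (W * (2 * S))))
        = 216 * P * W * S ^ 2 * n * (1 / (1 + R) ^ 3) := by ring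
      _ ≤ 216 * P * W * S ^ 2 * n * (1 / (1 + R)) := mul_le_mul_of_nonneg_left hq3 hK
  have hb3 : J₃ ≤ 216 * P * W * S ^ 2 * n * (1 / (1 + R)) := by
    refine (le_abs_self _).trans (h3.trans ?_)
    calc 4 * P * (27 * (n * (S / (1 + R) ^ 2) * (W * (2 * S))))
        = 216 * P * W * S ^ 2 * n * (1 / (1 + R) ^ 2) := by ring
      _ ≤ 216 * P * W * S ^ 2 * n * (1 / (1 + R)) := mul_le_mul_of_nonneg_left hq2 hK
  have hb5 : J₅ ≤ 1728 * P * W * S ^ 2 * n * (1 / (1 + R)) := by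
    refine (le_abs_self _).trans (h5.trans (le_of_eq ?_))
    ring
  have hb2 : -J₂ ≤ 216 * P * W * S * n ^ 2 := by
    refine (neg_le_abs _).trans (h2.trans (le_of_eq ?_))
    ring
  -- AM–GM on the linear terms
  have hlin : 2 * (J₁ + J₃ + J₅) ≤ n ^ 2 + (2160 * P * W * S ^ 2) ^ 2 / (1 + R) ^ 2 := by
    have h6 : J₁ + J₃ + J₅ ≤ (2160 * P * W * S ^ 2 / (1 + R)) * n := by
      have := add_le_add (add_le_add hb1 hb3) hb5
      refine this.trans (le_of_eq ?_)
      field_simp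
      ring
    have hamgm : 2 * ((2160 * P * W * S ^ 2 / (1 + R)) * n) ≤
        n ^ 2 + (2160 * P * W * S ^ 2 / (1 + R)) ^ 2 := by
      nlinarith [sq_nonneg (n - 2160 * P * W * S ^ 2 / (1 + R))]
    rw [div_pow] at hamgm
    linarith
  nlinarith [hb2, hlin]

set_option maxHeartbeats 800000 in
/-- **The differential inequality for the difference of two inviscid Galerkin solutions**
(Majda–Bertozzi 2002, Lemma 3.7, p. 108: "`d/dt ‖v^ε − v^{ε'}‖₀ ≤ C(M)[max(ε, ε') + ‖v^ε − v^{ε'}‖₀]`",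
with the terms `R1`–`R5` of its proof, `R5 = 0` by the cancellation). Fourier side, `c = 0`,
cut-off radii `0 ≤ R ≤ R'`, states `u` (radius `R`) and `v` (radius `R'`) in the phase space with
`E_3 ≤ 4(A+1)` and `u = a` a.e. off the ball `‖ξ‖ ≤ R`, for a datum with
`∫⁻ ((1+‖ξ‖)³‖a‖)² ≤ A`:
`2 Re ⟪u − v, F_R(u) − F_{R'}(v)⟫ ≤ (432πW(A+1)^{1/2} + 1) ‖u − v‖² + (2160πW(A+1))² / (1+R)²`.
[cite: MajdaBertozzi2002, Lemma 3.7 (3.61) pp. 107-108] -/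
theorem cauchy_deriv_le (hA : 0 ≤ A) (hR : 0 ≤ R) (hRR' : R ≤ R') {a : symSubspace}
    (hM : ∫⁻ ξ, (ENNReal.ofReal ((1 + ‖ξ‖) ^ 3) * ‖((a : 𝓗) : ℝ³ → ℂ³) ξ‖ₑ) ^ 2 ≤ ENNReal.ofReal A)
    {u v : symSubspace} (hu3 : truncEnergy 3 R (u : 𝓗) ≤ 4 * (A + 1))
    (hv3 : truncEnergy 3 R' (v : 𝓗) ≤ 4 * (A + 1))
    (hua : ∀ᵐ ξ ∂(volume : Measure ℝ³), R < ‖ξ‖ → ((u : 𝓗) : ℝ³ → ℂ³) ξ = ((a : 𝓗) : ℝ³ → ℂ³) ξ) :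
    2 * (⟪(u : 𝓗) - (v : 𝓗), (galerkinField 0 R u : 𝓗) - (galerkinField 0 R' v : 𝓗)⟫_ℂ).re ≤
      (432 * π * weightConst * Real.sqrt (A + 1) + 1) * ‖(u : 𝓗) - (v : 𝓗)‖ ^ 2 +
        (2160 * π * weightConst * (A + 1)) ^ 2 / (1 + R) ^ 2 := by
  have hS0 : 0 < Real.sqrt (A + 1) := Real.sqrt_pos.2 (by linarith)
  have hSsq : Real.sqrt (A + 1) ^ 2 = A + 1 := Real.sq_sqrt (by linarith)
  have hW0 : 0 ≤ weightConst := weightConst_nonneg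
  have hwmem : (u : 𝓗) - (v : 𝓗) ∈ symSubspace := Submodule.sub_mem _ u.2 v.2
  -- standard facts about the fields
  obtain ⟨hf2, hfw, hf1⟩ := truncCoeff_facts R (u : 𝓗)
  obtain ⟨hf'2, hf'w, hf'1⟩ := truncCoeff_facts R' (v : 𝓗)
  obtain ⟨hg'2, hg'w, hg'1⟩ := truncCoeff_facts R' ((u : 𝓗) - (v : 𝓗))
  obtain ⟨ha'2, ha'w, ha'1⟩ := truncCoeff_facts R' (a : 𝓗)
  obtain ⟨ha2, haw, ha1⟩ := truncCoeff_facts R (a : 𝓗)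
  have hfdiv := truncCoeff_divFree_ae R u.2
  have hfsym := truncCoeff_conjSymm_ae R u.2
  have hg'div := truncCoeff_divFree_ae R' hwmem
  have hδa2 : ∀ j, MemLp (fun ξ => truncCoeff R' (a : 𝓗) ξ j - truncCoeff R (a : 𝓗) ξ j) 2 volume :=
    fun j => (ha'2 j).sub (ha2 j)
  have hδaw : ∀ k, MemLp (fun η => ((‖η‖ : ℝ) : ℂ) *
      (truncCoeff R' (a : 𝓗) η k - truncCoeff R (a : 𝓗) η k)) 2 volume := fun k =>
    ((ha'w k).sub (haw k)).ae_eq (Eventually.of_forall fun η => by simp only [Pi.sub_apply, mul_sub])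
  have hδa1 : ∀ k, Integrable (fun η => ((‖η‖ : ℝ) : ℂ) *
      (truncCoeff R' (a : 𝓗) η k - truncCoeff R (a : 𝓗) η k)) volume := fun k =>
    ((ha'1 k).sub (ha1 k)).congr (Eventually.of_forall fun η => by simp only [Pi.sub_apply, mul_sub])
  have hδadiv : ∀ᵐ ζ ∂(volume : Measure ℝ³),
      ∑ j, ((ζ j : ℝ) : ℂ) * (truncCoeff R' (a : 𝓗) ζ j - truncCoeff R (a : 𝓗) ζ j) = 0 := by
    filter_upwards [truncCoeff_divFree_ae R' a.2, truncCoeff_divFree_ae R a.2] with ζ h1 h2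
    simp only [mul_sub, Finset.sum_sub_distrib, h1, h2, sub_zero]
  have hδam : AEStronglyMeasurable (fun ξ j => truncCoeff R' (a : 𝓗) ξ j - truncCoeff R (a : 𝓗) ξ j)
      volume :=
    (aestronglyMeasurable_truncCoeff R' (a : 𝓗)).sub (aestronglyMeasurable_truncCoeff R (a : 𝓗))
  have hr₅m : AEStronglyMeasurable (fun ξ l => (((cutoff R' ξ - cutoff R ξ) / (1 + ‖ξ‖) : ℝ) : ℂ) *
      coeff ((u : 𝓗) - (v : 𝓗)) ξ l) volume := by
    have : (fun ξ l => (((cutoff R' ξ - cutoff R ξ) / (1 + ‖ξ‖) : ℝ) : ℂ) * coeff ((u : 𝓗) - (v : 𝓗)) ξ l)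
        = fun ξ => (((cutoff R' ξ - cutoff R ξ) / (1 + ‖ξ‖) : ℝ) : ℂ) • coeff ((u : 𝓗) - (v : 𝓗)) ξ := by
      funext ξ l; simp only [Pi.smul_apply, smul_eq_mul]
    rw [this]
    refine (Complex.continuous_ofReal.measurable.comp ?_).aestronglyMeasurable.smul
      (aestronglyMeasurable_coeff _)
    exact ((measurable_cutoff R').sub (measurable_cutoff R)).div (measurable_const.add measurable_norm)
  -- norm bounds in `ℝ≥0∞`
  have hWc : weightConstENNReal = ENNReal.ofReal weightConst := ofReal_weightConst.symm
  have hX : ∀ ρ l, (∫⁻ ξ, ‖truncCoeff ρ ((u : 𝓗) - (v : 𝓗)) ξ l‖ₑ ^ 2) ^ (1 / 2 : ℝ) ≤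
      ENNReal.ofReal ‖(u : 𝓗) - (v : 𝓗)‖ := fun ρ l => lintegral_truncCoeff_sq_rpow_le ρ _ l
  have hZ : ∀ {ρ : ℝ} {z : 𝓗}, truncEnergy 3 ρ z ≤ 4 * (A + 1) → ∀ k,
      ∫⁻ η, ENNReal.ofReal ‖η‖ * ‖truncCoeff ρ z η k‖ₑ ≤
        ENNReal.ofReal (weightConst * (2 * Real.sqrt (A + 1))) := fun {ρ z} hz k => by
    refine (lintegral_norm_mul_truncCoeff_le ρ z k).trans ?_
    rw [ENNReal.ofReal_mul hW0, hWc]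
    exact mul_le_mul_right (ofReal_rpow_half_le_of_le hz (truncEnergy_nonneg 3 ρ z)) _
  have hZ1 : ∀ {ρ : ℝ} {z : 𝓗}, truncEnergy 3 ρ z ≤ 4 * (A + 1) → ∀ j,
      ∫⁻ ζ, ‖truncCoeff ρ z ζ j‖ₑ ≤ ENNReal.ofReal (weightConst * (2 * Real.sqrt (A + 1))) :=
    fun {ρ z} hz j => by
    refine (lintegral_enorm_truncCoeff_le ρ z j).trans ?_
    rw [ENNReal.ofReal_mul hW0, hWc]
    exact mul_le_mul_right (ofReal_rpow_half_le_of_le hz (truncEnergy_nonneg 3 ρ z)) _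
  have hMS : (∫⁻ ξ, (ENNReal.ofReal ((1 + ‖ξ‖) ^ 3) * ‖((a : 𝓗) : ℝ³ → ℂ³) ξ‖ₑ) ^ 2) ^ (1 / 2 : ℝ) ≤
      ENNReal.ofReal (Real.sqrt (A + 1)) := by
    refine (ENNReal.rpow_le_rpow hM (by norm_num)).trans ?_
    rw [ENNReal.ofReal_rpow_of_nonneg hA (by norm_num), ← Real.sqrt_eq_rpow]
    exact ENNReal.ofReal_le_ofReal (Real.sqrt_le_sqrt (by linarith))
  have hYδa : ∀ j, (∫⁻ ξ, ‖truncCoeff R' (a : 𝓗) ξ j - truncCoeff R (a : 𝓗) ξ j‖ₑ ^ 2) ^ (1 / 2 : ℝ) ≤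
      ENNReal.ofReal (Real.sqrt (A + 1) / (1 + R) ^ 3) := fun j => by
    refine (lintegral_tail_sq_rpow_le hR hRR' (a : 𝓗) j).trans ?_
    have : ENNReal.ofReal (Real.sqrt (A + 1) / (1 + R) ^ 3) =
        (ENNReal.ofReal ((1 + R) ^ 3))⁻¹ * ENNReal.ofReal (Real.sqrt (A + 1)) := by
      rw [div_eq_inv_mul, ENNReal.ofReal_mul (by positivity), ENNReal.ofReal_inv_of_pos (by positivity)]
    rw [this]
    exact mul_le_mul_right hMS _
  have hYδaw : ∀ k, (∫⁻ ξ, (ENNReal.ofReal ‖ξ‖ *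
      ‖truncCoeff R' (a : 𝓗) ξ k - truncCoeff R (a : 𝓗) ξ k‖ₑ) ^ 2) ^ (1 / 2 : ℝ) ≤
      ENNReal.ofReal (Real.sqrt (A + 1) / (1 + R) ^ 2) := fun k => by
    refine (lintegral_norm_mul_tail_sq_rpow_le hR hRR' (a : 𝓗) k).trans ?_
    have : ENNReal.ofReal (Real.sqrt (A + 1) / (1 + R) ^ 2) =
        (ENNReal.ofReal ((1 + R) ^ 2))⁻¹ * ENNReal.ofReal (Real.sqrt (A + 1)) := by
      rw [div_eq_inv_mul, ENNReal.ofReal_mul (by positivity), ENNReal.ofReal_inv_of_pos (by positivity)]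
    rw [this]
    exact mul_le_mul_right hMS _
  have hXr₅ : ∀ l, (∫⁻ ξ, ‖(((cutoff R' ξ - cutoff R ξ) / (1 + ‖ξ‖) : ℝ) : ℂ) *
      coeff ((u : 𝓗) - (v : 𝓗)) ξ l‖ₑ ^ 2) ^ (1 / 2 : ℝ) ≤ ENNReal.ofReal (‖(u : 𝓗) - (v : 𝓗)‖ / (1 + R)) :=
    fun l => by
    refine (lintegral_cutoff_diff_div_sq_rpow_le hR hRR' _ l).trans (le_of_eq ?_)
    rw [div_eq_inv_mul, ENNReal.ofReal_mul (by positivity), ENNReal.ofReal_inv_of_pos (by positivity)]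
  have hY1f : ∀ j, (∫⁻ ζ, (ENNReal.ofReal ((1 + ‖ζ‖) ^ 1) * ‖truncCoeff R (u : 𝓗) ζ j‖ₑ) ^ 2) ^
      (1 / 2 : ℝ) ≤ ENNReal.ofReal (2 * Real.sqrt (A + 1)) := fun j => by
    refine (ENNReal.rpow_le_rpow (lintegral_weightfun_truncCoeff_sq_le (fun ξ =>
      ENNReal.ofReal_le_ofReal (pow_le_pow_right₀ (one_le_one_add_norm ξ) (by norm_num))) R (u : 𝓗) j)
      (by norm_num)).trans ?_
    exact ofReal_rpow_half_le_of_le hu3 (truncEnergy_nonneg 3 R _)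
  have hY2f : ∀ k, (∫⁻ η, (ENNReal.ofReal ((1 + ‖η‖) ^ 1) *
      (ENNReal.ofReal ‖η‖ * ‖truncCoeff R (u : 𝓗) η k‖ₑ)) ^ 2) ^ (1 / 2 : ℝ) ≤
      ENNReal.ofReal (2 * Real.sqrt (A + 1)) := fun k => by
    have hw : ∀ η : ℝ³, ENNReal.ofReal ((1 + ‖η‖) ^ 1) * ENNReal.ofReal ‖η‖ ≤
        ENNReal.ofReal ((1 + ‖η‖) ^ 3) := fun η => by
      rw [← ENNReal.ofReal_mul (by positivity)]
      refine ENNReal.ofReal_le_ofReal ?_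
      have h0 := norm_nonneg η
      rw [pow_one]
      nlinarith [sq_nonneg ‖η‖, mul_nonneg h0 (sq_nonneg ‖η‖)]
    have h1 := lintegral_weightfun_truncCoeff_sq_le hw R (u : 𝓗) k
    refine (ENNReal.rpow_le_rpow ((lintegral_congr fun η => by rw [mul_assoc]).trans_le h1)
      (by norm_num)).trans ?_
    exact ofReal_rpow_half_le_of_le hu3 (truncEnergy_nonneg 3 R _)
  -- the five pairings and their bounds
  have hnw := norm_nonneg ((u : 𝓗) - (v : 𝓗))
  have h2S : 0 ≤ weightConst * (2 * Real.sqrt (A + 1)) := by positivity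
  have hJ₁ := abs_re_pairing_le_of_bounds hδadiv hδa2 hf'2 hf'w
    (aestronglyMeasurable_truncCoeff R' ((u : 𝓗) - (v : 𝓗))) hnw (by positivity) h2S
    (hX R') hYδa (hZ hv3)
  have hJ₂ := abs_re_pairing_le_of_bounds hg'div hg'2 hf'2 hf'w
    (aestronglyMeasurable_truncCoeff R' ((u : 𝓗) - (v : 𝓗))) hnw hnw h2S (hX R') (hX R') (hZ hv3)
  have hJ₃ := abs_re_pairing_le_of_bounds' hfdiv hf2 hδa2 hδaw
    (aestronglyMeasurable_truncCoeff R' ((u : 𝓗) - (v : 𝓗))) hnw (by positivity) h2S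
    (hX R') hYδaw (hZ1 hu3)
  have hJ₄ := re_integral_sum_nonlin_mul_conj_eq_zero hfdiv hfsym (integrable_truncCoeff R (u : 𝓗)) hf2
    (aestronglyMeasurable_truncCoeff R' ((u : 𝓗) - (v : 𝓗))) hg'2 hg'w hg'div
  have hJ₄i := (abs_re_pairing_le_of_bounds hfdiv hf2 hg'2 hg'w
    (aestronglyMeasurable_truncCoeff R' ((u : 𝓗) - (v : 𝓗))) hnw (norm_nonneg (u : 𝓗))
    (by positivity : 0 ≤ weightConst * Real.sqrt (truncEnergy 3 R' ((u : 𝓗) - (v : 𝓗))))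
    (hX R') (fun j => lintegral_truncCoeff_sq_rpow_le R (u : 𝓗) j) (fun k => by
      refine (lintegral_norm_mul_truncCoeff_le R' _ k).trans (le_of_eq ?_)
      rw [ENNReal.ofReal_mul hW0, hWc, ENNReal.ofReal_rpow_of_nonneg (truncEnergy_nonneg 3 R' _)
        (by norm_num), Real.sqrt_eq_rpow])).2
  have hJ₅ := abs_re_weight_pairing_le_of_bounds hfdiv hf2 hf2 hfw hr₅m (by positivity) (by positivity)
    h2S (by positivity) h2S hXr₅ hY1f (hZ hu3) hY2f (hZ1 hu3)
  have hIi := (abs_re_pairing_le_of_bounds hfdiv hf2 hf2 hfw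
    (aestronglyMeasurable_truncCoeff R ((u : 𝓗) - (v : 𝓗))) hnw (norm_nonneg (u : 𝓗)) h2S
    (hX R) (fun j => lintegral_truncCoeff_sq_rpow_le R (u : 𝓗) j) (hZ hu3)).2
  have hI'i := (abs_re_pairing_le_of_bounds (truncCoeff_divFree_ae R' v.2) hf'2 hf'2 hf'w
    (aestronglyMeasurable_truncCoeff R' ((u : 𝓗) - (v : 𝓗))) hnw (norm_nonneg (v : 𝓗)) h2S
    (hX R') (fun j => lintegral_truncCoeff_sq_rpow_le R' (v : 𝓗) j) (hZ hv3)).2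
  -- the tail identity, transported through the nonlinearity
  have hae := truncCoeff_sub_truncCoeff_ae (v := (v : 𝓗)) hRR' hua
  have hae' : ∀ᵐ ξ ∂(volume : Measure ℝ³), (truncCoeff R' (v : 𝓗) - truncCoeff R (u : 𝓗)) ξ =
      ((fun ξ j => truncCoeff R' (a : 𝓗) ξ j - truncCoeff R (a : 𝓗) ξ j) -
        truncCoeff R' ((u : 𝓗) - (v : 𝓗))) ξ :=
    hae.mono fun ξ hξ => by
      funext j
      have := congr_fun hξ j
      simpa only [Pi.sub_apply] using this
  have hN1 := nonlin_congr_ae (w := truncCoeff R' (v : 𝓗)) hae' (ae_of_all _ fun _ => rfl)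
  have hN2 := nonlin_congr_ae (v := truncCoeff R (u : 𝓗)) (ae_of_all _ fun _ => rfl) hae'
  -- pointwise decomposition of the integrand
  have hpt : ∀ ξ, (∑ l, nonlin (truncCoeff R' (v : 𝓗)) (truncCoeff R' (v : 𝓗)) ξ l *
        conj (truncCoeff R' ((u : 𝓗) - (v : 𝓗)) ξ l)) -
      ∑ l, nonlin (truncCoeff R (u : 𝓗)) (truncCoeff R (u : 𝓗)) ξ l *
        conj (truncCoeff R ((u : 𝓗) - (v : 𝓗)) ξ l) =
      (∑ l, nonlin (fun ξ j => truncCoeff R' (a : 𝓗) ξ j - truncCoeff R (a : 𝓗) ξ j)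
          (truncCoeff R' (v : 𝓗)) ξ l * conj (truncCoeff R' ((u : 𝓗) - (v : 𝓗)) ξ l)) -
      (∑ l, nonlin (truncCoeff R' ((u : 𝓗) - (v : 𝓗))) (truncCoeff R' (v : 𝓗)) ξ l *
          conj (truncCoeff R' ((u : 𝓗) - (v : 𝓗)) ξ l)) +
      (∑ l, nonlin (truncCoeff R (u : 𝓗)) (fun ξ j => truncCoeff R' (a : 𝓗) ξ j - truncCoeff R (a : 𝓗) ξ j)
          ξ l * conj (truncCoeff R' ((u : 𝓗) - (v : 𝓗)) ξ l)) -
      (∑ l, nonlin (truncCoeff R (u : 𝓗)) (truncCoeff R' ((u : 𝓗) - (v : 𝓗))) ξ l *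
          conj (truncCoeff R' ((u : 𝓗) - (v : 𝓗)) ξ l)) +
      ∑ l, (((1 + ‖ξ‖ : ℝ)) : ℂ) * (nonlin (truncCoeff R (u : 𝓗)) (truncCoeff R (u : 𝓗)) ξ l *
          conj ((((cutoff R' ξ - cutoff R ξ) / (1 + ‖ξ‖) : ℝ) : ℂ) * coeff ((u : 𝓗) - (v : 𝓗)) ξ l)) := by
    intro ξ
    rw [← Finset.sum_sub_distrib]
    simp only [← Finset.sum_sub_distrib, ← Finset.sum_add_distrib]
    refine Finset.sum_congr rfl fun l _ => ?_
    have c1 := congr_fun (nonlin_sub_left_of_memLp hf'2 hf2 hf'2 ξ) l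
    have c2 := congr_fun (nonlin_sub_right_of_memLp hf2 hf'2 hf2 ξ) l
    have c3 := congr_fun (nonlin_sub_left_of_memLp hδa2 hg'2 hf'2 ξ) l
    have c4 := congr_fun (nonlin_sub_right_of_memLp hf2 hδa2 hg'2 ξ) l
    have c5 := congr_fun (congr_fun hN1 ξ) l
    have c6 := congr_fun (congr_fun hN2 ξ) l
    simp only [Pi.sub_apply] at c1 c2 c3 c4
    have E2 : conj (truncCoeff R' ((u : 𝓗) - (v : 𝓗)) ξ l) = conj (truncCoeff R ((u : 𝓗) - (v : 𝓗)) ξ l) +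
        (((1 + ‖ξ‖ : ℝ)) : ℂ) * conj ((((cutoff R' ξ - cutoff R ξ) / (1 + ‖ξ‖) : ℝ) : ℂ) *
          coeff ((u : 𝓗) - (v : 𝓗)) ξ l) := by
      have hρ : (1 + ‖ξ‖ : ℝ) ≠ 0 := by positivity
      simp only [truncCoeff_apply, map_mul, Complex.conj_ofReal]
      rw [← mul_assoc, ← Complex.ofReal_mul, mul_div_cancel₀ _ hρ]
      push_cast
      ring
    linear_combination conj (truncCoeff R' ((u : 𝓗) - (v : 𝓗)) ξ l) * (c5 + c6 + c3 + c4 - c1 - c2) +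
      nonlin (truncCoeff R (u : 𝓗)) (truncCoeff R (u : 𝓗)) ξ l * E2
  -- integrate the decomposition
  have hI : (∫ ξ, ∑ l, nonlin (truncCoeff R' (v : 𝓗)) (truncCoeff R' (v : 𝓗)) ξ l *
        conj (truncCoeff R' ((u : 𝓗) - (v : 𝓗)) ξ l)) -
      (∫ ξ, ∑ l, nonlin (truncCoeff R (u : 𝓗)) (truncCoeff R (u : 𝓗)) ξ l *
        conj (truncCoeff R ((u : 𝓗) - (v : 𝓗)) ξ l)) =
      (∫ ξ, ∑ l, nonlin (fun ξ j => truncCoeff R' (a : 𝓗) ξ j - truncCoeff R (a : 𝓗) ξ j)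
          (truncCoeff R' (v : 𝓗)) ξ l * conj (truncCoeff R' ((u : 𝓗) - (v : 𝓗)) ξ l)) -
      (∫ ξ, ∑ l, nonlin (truncCoeff R' ((u : 𝓗) - (v : 𝓗))) (truncCoeff R' (v : 𝓗)) ξ l *
          conj (truncCoeff R' ((u : 𝓗) - (v : 𝓗)) ξ l)) +
      (∫ ξ, ∑ l, nonlin (truncCoeff R (u : 𝓗))
          (fun ξ j => truncCoeff R' (a : 𝓗) ξ j - truncCoeff R (a : 𝓗) ξ j) ξ l *
          conj (truncCoeff R' ((u : 𝓗) - (v : 𝓗)) ξ l)) -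
      (∫ ξ, ∑ l, nonlin (truncCoeff R (u : 𝓗)) (truncCoeff R' ((u : 𝓗) - (v : 𝓗))) ξ l *
          conj (truncCoeff R' ((u : 𝓗) - (v : 𝓗)) ξ l)) +
      ∫ ξ, ∑ l, (((1 + ‖ξ‖ : ℝ)) : ℂ) * (nonlin (truncCoeff R (u : 𝓗)) (truncCoeff R (u : 𝓗)) ξ l *
          conj ((((cutoff R' ξ - cutoff R ξ) / (1 + ‖ξ‖) : ℝ) : ℂ) * coeff ((u : 𝓗) - (v : 𝓗)) ξ l)) := by
    have hX2 := hJ₁.2.sub hJ₂.2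
    have hX3 := hX2.add hJ₃.2
    have hX4 := hX3.sub hJ₄i
    have hpt' : ∀ ξ, (∑ l, nonlin (truncCoeff R' (v : 𝓗)) (truncCoeff R' (v : 𝓗)) ξ l *
          conj (truncCoeff R' ((u : 𝓗) - (v : 𝓗)) ξ l)) -
        ∑ l, nonlin (truncCoeff R (u : 𝓗)) (truncCoeff R (u : 𝓗)) ξ l *
          conj (truncCoeff R ((u : 𝓗) - (v : 𝓗)) ξ l) =
        (((((fun ξ => ∑ l, nonlin (fun ξ j => truncCoeff R' (a : 𝓗) ξ j - truncCoeff R (a : 𝓗) ξ j)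
            (truncCoeff R' (v : 𝓗)) ξ l * conj (truncCoeff R' ((u : 𝓗) - (v : 𝓗)) ξ l)) -
          (fun ξ => ∑ l, nonlin (truncCoeff R' ((u : 𝓗) - (v : 𝓗))) (truncCoeff R' (v : 𝓗)) ξ l *
            conj (truncCoeff R' ((u : 𝓗) - (v : 𝓗)) ξ l))) +
          (fun ξ => ∑ l, nonlin (truncCoeff R (u : 𝓗))
            (fun ξ j => truncCoeff R' (a : 𝓗) ξ j - truncCoeff R (a : 𝓗) ξ j) ξ l *
            conj (truncCoeff R' ((u : 𝓗) - (v : 𝓗)) ξ l))) -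
          (fun ξ => ∑ l, nonlin (truncCoeff R (u : 𝓗)) (truncCoeff R' ((u : 𝓗) - (v : 𝓗))) ξ l *
            conj (truncCoeff R' ((u : 𝓗) - (v : 𝓗)) ξ l))) +
          (fun ξ => ∑ l, (((1 + ‖ξ‖ : ℝ)) : ℂ) * (nonlin (truncCoeff R (u : 𝓗)) (truncCoeff R (u : 𝓗)) ξ l *
            conj ((((cutoff R' ξ - cutoff R ξ) / (1 + ‖ξ‖) : ℝ) : ℂ) * coeff ((u : 𝓗) - (v : 𝓗)) ξ l)))) ξ :=
      fun ξ => by simp only [Pi.add_apply, Pi.sub_apply]; exact hpt ξ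
    rw [← integral_sub hI'i hIi, integral_congr_ae (ae_of_all _ hpt'), integral_add' hX4 hJ₅.2,
      integral_sub' hX3 hJ₄i, integral_add' hX2 hJ₃.2, integral_sub' hJ₁.2 hJ₂.2]
  -- conclusion
  rw [inner_sub_galerkinField_zero, hI]
  simp only [Complex.sub_re, Complex.add_re, hJ₄, sub_zero]
  have h := cauchy_arith Real.pi_pos.le hW0 hnw hR hJ₁.1 hJ₂.1 hJ₃.1 hJ₅.1
  rw [hSsq] at h
  exact h

end Difference

/-! ### The Cauchy estimate -/

section Cauchy

/-- The Hilbert space `L²(ℝ³; ℂ³)` of Fourier coefficient fields. -/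
local notation "𝓗" => Lp (EuclideanSpace ℂ (Fin 3)) 2 (volume : Measure (EuclideanSpace ℝ (Fin 3)))

/-- The constant of the Cauchy estimate: `D(A) = 2160 π W (A+1) exp((432πW(A+1)^{1/2} + 1) τ(A)/2)`,
`τ(A) = lifespan A`, `W = weightConst` (not optimised). [cite: MajdaBertozzi2002, Lemma 3.7 (3.61) p. 107] -/
def cauchyConst (A : ℝ) : ℝ :=
  2160 * π * weightConst * (A + 1) *
    Real.exp ((432 * π * weightConst * Real.sqrt (A + 1) + 1) * lifespan A / 2)

/-- `D(A) ≥ 0` for `A ≥ 0`. [folklore] -/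
theorem cauchyConst_nonneg {A : ℝ} (hA : 0 ≤ A) : 0 ≤ cauchyConst A := by
  unfold cauchyConst
  have := weightConst_nonneg
  positivity

/-- The initial weighted energy of a Galerkin solution is bounded by the `H³` moment of the datum.
[folklore] -/
theorem truncEnergy_three_initial_le {A : ℝ} (hA : 0 ≤ A) (R : ℝ) {a : 𝓗}
    (hM : ∫⁻ ξ, (ENNReal.ofReal ((1 + ‖ξ‖) ^ 3) *
      ‖(a : EuclideanSpace ℝ (Fin 3) → EuclideanSpace ℂ (Fin 3)) ξ‖ₑ) ^ 2 ≤ ENNReal.ofReal A) :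
    truncEnergy 3 R a ≤ A :=
  (ENNReal.ofReal_le_ofReal_iff hA).1 ((ofReal_truncEnergy_le_lintegral 3 R a).trans hM)

/-- **The Galerkin solutions are Cauchy in `C([0, T]; L²)` as the cut-off is removed**
(Majda–Bertozzi 2002, Lemma 3.7 (3.61): "`sup_{0≤t≤T} ‖v^ε − v^{ε'}‖₀ ≤ C ε`", Fourier side,
inviscid case): two inviscid Galerkin solutions with cut-off radii `0 ≤ R ≤ R'` issued from the same
datum `a` of the phase space with `∫⁻ ((1+‖ξ‖)³‖a‖)² ≤ A` satisfy
`‖α_R(t) − α_{R'}(t)‖ ≤ D(A)/(1+R)` for `0 ≤ t ≤ T ≤ τ(A)` (Grönwall on `cauchy_deriv_le`).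
[cite: MajdaBertozzi2002, Lemma 3.7 (3.61) p. 107] -/
theorem norm_sub_le_of_galerkin_solutions {A R R' T : ℝ} (hA : 0 ≤ A) (hR : 0 ≤ R) (hRR' : R ≤ R')
    (hT : T ≤ lifespan A) {a : symSubspace}
    (hM : ∫⁻ ξ, (ENNReal.ofReal ((1 + ‖ξ‖) ^ 3) *
      ‖((a : 𝓗) : EuclideanSpace ℝ (Fin 3) → EuclideanSpace ℂ (Fin 3)) ξ‖ₑ) ^ 2 ≤ ENNReal.ofReal A)
    {α β : ℝ → symSubspace}
    (hα : ∀ t ∈ Icc 0 T, HasDerivWithinAt α (galerkinField 0 R (α t)) (Icc 0 T) t) (hα0 : α 0 = a)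
    (hβ : ∀ t ∈ Icc 0 T, HasDerivWithinAt β (galerkinField 0 R' (β t)) (Icc 0 T) t) (hβ0 : β 0 = a) :
    ∀ t ∈ Icc 0 T, ‖(α t : 𝓗) - (β t : 𝓗)‖ ≤ cauchyConst A / (1 + R) := by
  intro t ht
  have hW0 := weightConst_nonneg
  have hKpos : 0 < 432 * π * weightConst * Real.sqrt (A + 1) + 1 := by
    have : 0 ≤ 432 * π * weightConst * Real.sqrt (A + 1) := by positivity
    linarith
  have hL0 : 0 ≤ 2160 * π * weightConst * (A + 1) := by positivity
  have hderiv : ∀ τ ∈ Icc 0 T, HasDerivWithinAt (fun τ => ‖(α τ : 𝓗) - (β τ : 𝓗)‖ ^ 2)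
      (2 * (⟪(α τ : 𝓗) - (β τ : 𝓗),
        (galerkinField 0 R (α τ) : 𝓗) - (galerkinField 0 R' (β τ) : 𝓗)⟫_ℂ).re) (Icc 0 T) τ := fun τ hτ =>
    hasDerivWithinAt_norm_sq (β := fun τ => (α τ : 𝓗) - (β τ : 𝓗))
      ((hasDerivWithinAt_coe_of_galerkinField (hα τ hτ)).sub (hasDerivWithinAt_coe_of_galerkinField (hβ τ hτ)))
  have hcont : ContinuousOn (fun τ => ‖(α τ : 𝓗) - (β τ : 𝓗)‖ ^ 2) (Icc 0 T) := fun τ hτ =>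
    (hderiv τ hτ).continuousWithinAt
  have hα3 := truncEnergy_three_le le_rfl hA hT hα (by rw [hα0]; exact truncEnergy_three_initial_le hA R hM)
  have hβ3 := truncEnergy_three_le le_rfl hA hT hβ (by rw [hβ0]; exact truncEnergy_three_initial_le hA R' hM)
  have hbound : ∀ τ ∈ Ico 0 T, 2 * (⟪(α τ : 𝓗) - (β τ : 𝓗),
        (galerkinField 0 R (α τ) : 𝓗) - (galerkinField 0 R' (β τ) : 𝓗)⟫_ℂ).re ≤
      (432 * π * weightConst * Real.sqrt (A + 1) + 1) * ‖(α τ : 𝓗) - (β τ : 𝓗)‖ ^ 2 +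
        (2160 * π * weightConst * (A + 1)) ^ 2 / (1 + R) ^ 2 := by
    intro τ hτ
    have hτ' : τ ∈ Icc 0 T := Ico_subset_Icc_self hτ
    have hua : ∀ᵐ ξ ∂(volume : Measure (EuclideanSpace ℝ (Fin 3))), R < ‖ξ‖ →
        ((α τ : 𝓗) : EuclideanSpace ℝ (Fin 3) → EuclideanSpace ℂ (Fin 3)) ξ =
          ((a : 𝓗) : EuclideanSpace ℝ (Fin 3) → EuclideanSpace ℂ (Fin 3)) ξ := by
      rw [← hα0]; exact galerkin_solution_eq_initial_of_lt 0 R hα hτ'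
    exact cauchy_deriv_le hA hR hRR' hM (hα3 τ hτ') (hβ3 τ hτ') hua
  have h0 : ‖(α 0 : 𝓗) - (β 0 : 𝓗)‖ ^ 2 ≤ 0 := by rw [hα0, hβ0, sub_self, norm_zero]; norm_num
  have hgron := le_gronwallBound_of_liminf_deriv_right_le
    (f := fun τ => ‖(α τ : 𝓗) - (β τ : 𝓗)‖ ^ 2)
    (f' := fun τ => 2 * (⟪(α τ : 𝓗) - (β τ : 𝓗),
        (galerkinField 0 R (α τ) : 𝓗) - (galerkinField 0 R' (β τ) : 𝓗)⟫_ℂ).re)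
    (δ := 0) (K := 432 * π * weightConst * Real.sqrt (A + 1) + 1)
    (ε := (2160 * π * weightConst * (A + 1)) ^ 2 / (1 + R) ^ 2) (a := 0) (b := T) hcont
    (fun τ hτ r hr => ?_) h0 hbound t ht
  · -- unwind the Grönwall bound
    rw [gronwallBound_of_K_ne_0 hKpos.ne'] at hgron
    simp only [sub_zero, zero_mul, zero_add] at hgron
    have hτA : t ≤ lifespan A := ht.2.trans hT
    have h1 : ‖(α t : 𝓗) - (β t : 𝓗)‖ ^ 2 ≤ (2160 * π * weightConst * (A + 1) / (1 + R) *
        Real.exp ((432 * π * weightConst * Real.sqrt (A + 1) + 1) * lifespan A / 2)) ^ 2 := by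
      refine hgron.trans ?_
      have hE : Real.exp ((432 * π * weightConst * Real.sqrt (A + 1) + 1) * t) - 1 ≤
          Real.exp ((432 * π * weightConst * Real.sqrt (A + 1) + 1) * lifespan A / 2) ^ 2 := by
        rw [← Real.exp_nat_mul]
        push_cast
        have : Real.exp ((432 * π * weightConst * Real.sqrt (A + 1) + 1) * t) ≤
            Real.exp (2 * ((432 * π * weightConst * Real.sqrt (A + 1) + 1) * lifespan A / 2)) :=
          Real.exp_le_exp.2 (by nlinarith)
        linarith [Real.exp_pos ((432 * π * weightConst * Real.sqrt (A + 1) + 1) * t)]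
      have hq : (2160 * π * weightConst * (A + 1)) ^ 2 / (1 + R) ^ 2 /
          (432 * π * weightConst * Real.sqrt (A + 1) + 1) ≤
          (2160 * π * weightConst * (A + 1) / (1 + R)) ^ 2 := by
        rw [div_pow, div_le_iff₀ hKpos]
        have h0' : 0 ≤ (2160 * π * weightConst * (A + 1)) ^ 2 / (1 + R) ^ 2 := by positivity
        have hK1 : 1 ≤ 432 * π * weightConst * Real.sqrt (A + 1) + 1 := by
          have : 0 ≤ 432 * π * weightConst * Real.sqrt (A + 1) := by positivity
          linarith
        nlinarith [mul_le_mul_of_nonneg_left hK1 h0']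
      calc (2160 * π * weightConst * (A + 1)) ^ 2 / (1 + R) ^ 2 /
            (432 * π * weightConst * Real.sqrt (A + 1) + 1) *
            (Real.exp ((432 * π * weightConst * Real.sqrt (A + 1) + 1) * t) - 1)
          ≤ (2160 * π * weightConst * (A + 1) / (1 + R)) ^ 2 *
            Real.exp ((432 * π * weightConst * Real.sqrt (A + 1) + 1) * lifespan A / 2) ^ 2 := by
            refine mul_le_mul hq hE ?_ (by positivity)
            linarith [Real.add_one_le_exp ((432 * π * weightConst * Real.sqrt (A + 1) + 1) * t),
              mul_nonneg hKpos.le ht.1]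
        _ = _ := by ring
    have h2 := (pow_le_pow_iff_left₀ (norm_nonneg _) (by positivity) two_ne_zero).1 h1
    refine h2.trans (le_of_eq ?_)
    rw [cauchyConst]
    ring
  · have hmem_nhds : Icc 0 T ∈ 𝓝[Ici τ] τ :=
      mem_nhdsWithin.2 ⟨Iio T, isOpen_Iio, hτ.2, fun z hz => ⟨hτ.1.trans hz.2, hz.1.le⟩⟩
    exact ((hderiv τ (Ico_subset_Icc_self hτ)).mono_of_mem_nhdsWithin hmem_nhds)
      |>.liminf_right_slope_le hr

end Cauchy

end Literature.Analysis.FluidPDE.FourierNS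

end
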